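/-
Copyright: lit-balaban Phase-2 proof seat p34 (gen 21).  Statement-level skeleton of a published paper; no proof claims beyond what the
kernel checks below.
-/
import Literature.MathematicalPhysics.QuantumFieldTheory.BalabanImbrieJaffe1984to88.BIJ88NeumannPropagatorSmallFieldCloseDeriv
import Literature.MathematicalPhysics.QuantumFieldTheory.BalabanImbrieJaffe1984to88.BIJ88NeumannPropagatorSmoothNearClose
import Literature.MathematicalPhysics.QuantumFieldTheory.BalabanImbrieJaffe1984to88.BIJ88NeumannPropagatorSmoothNearRegionHolder

/-!
# [BalabanImbrieJaffe1988] p. 263 (2.31)–(2.32) / [BalabanImbrieJaffe1985] §7.3 p. 326 ⟵ [Balaban1983RegularityDecay] Theorem p. 573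
# (1.11)–(1.12): **THE `δG_k(□, Ω)` COVARIANT-DERIVATIVE MEMBER, AND THE VALUE/DERIVATIVE CLOSENESS MEMBERS HYPOTHESIS-FREE, FOR A `U(1)`
# FIELD PLAQUETTE-SMALL NEAR `Ω` ONLY — the printed LOCAL hypothesis (2.32)** (file C-III of the TAKING: the local (H1) input of p29's
# `BIJ88Loc231RegionOfInputs` chains; files C-I/C-II = `BIJ88NeumannPropagatorSmoothNearClose` / `BIJ88DeltaLocSmoothNearRegionCwt`)

T. Bałaban, J. Imbrie, A. Jaffe, *Effective action and cluster properties of the abelian Higgs model*, Commun. Math. Phys. **114** (1988)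
257–315 [BalabanImbrieJaffe1988], Sect. 2 p. 263 [PDF 7]: *"|(G_{k,loc}(u)f − G_k(Ω,u)f)(x)| ≦ e^{−cr(e_k)}e^{−c dist(suppt f,x)}‖f‖_∞ for
dist(x, Ω^c) ≧ O(r(e_k)). (2.31) … We assume that u is smooth in the □_α's entering the sum in (2.27); for (2.31) we assume smoothness
throughout the subset Ω ⊂ T_η. This means that in a neighborhood of each □_α there exists an A, λ such that u = exp[ie_kη(A + ∂λ)] with
|∂A|, |∂*A| ≦ O(p(e_k)). (2.32) … Bounds analogous to (2.30), (2.31) hold for covariant derivatives and Holder derivatives of G_{k,loc}(u) of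
order less than two."*; [I] = T. Bałaban, J. Imbrie, A. Jaffe, *Renormalization of the Higgs model: minimizers, propagators and the stability of
mean field theory*, Commun. Math. Phys. **97** (1985) 299–329 [BalabanImbrieJaffe1985], §7.3 p. 326 [PDF 28]: *"The propagators arising from
Δ_k(u_k) … also satisfy the regularity and decay estimates of [7]. In order to remain within the framework of this reference, we remark that
by change of gauge u_k can be transformed in a local region Λ into a configuration of the form exp[ie_kηA], where A is smooth and small."*;
[6] = [7] of [I] = T. Bałaban, *Regularity and decay of lattice Green's functions*, Commun. Math. Phys. **89** (1983) 571–597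
[Balaban1983RegularityDecay], Theorem p. 573 [PDF 3]: *"If Ω ⊂ Ω₀, then for δG_k(Ω,Ω₀,A) defined by the equality δG_k(Ω,Ω₀,A) = G_k(Ω,A) −
G_k(Ω₀,A), (1.11) we have the inequalities (1.5) and (1.6) (with the same restrictions on x, x′) with the additional factor (1.12) on the
right hand sides. For some simple sets Ω, e.g. for rectangular parallelepipeds, the inequalities hold without any restrictions on the points
x, x′"*.

statement-level skeleton of published theorems with citation tags; proofs where landed; nothing here is a claim about the Yang–Mills mass gap

PDFs held: `paper:balaban1988-cmp114-bij-abelian-higgs-effective-action` (p. 263 = PDF 7, re-read this session: text layer lines 16–25);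
`paper:balaban1985-cmp97-bij-higgs-minimizers` (p. 326 = PDF 28); `paper:balaban1983-cmp89-regularity-decay` (p. 573 = PDF 3).

CITATION HEADER (lean-in-tree rule).  Part of the lit-balaban TYPED SKELETON (HOME `run/shared/lean/pub/lit-balaban/`), PHASE-2 proof seat
p34 gen 21 (unit `lit-balaban-p34-g21`; TAKING line HOME/STATUS.md 2026-08-23T12:07:14Z, free-target protocol G.5-34(d); file C-III added
at p29 gen 33's request 12:26:25Z).  WHAT IS REPRODUCED: located MEMBERS of rows **C2.Eq2.31** / **C2.Eq2.32** / **C2.Claim@263** (owner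
r18; `C2S14-CLOSURE.md` §6 row «u smooth NEAR Ω only — the printed (2.32)», cells D / Hθ: the LOCAL (H1) input of p29's
`BIJ88Loc231RegionOfInputs.deriv231_region_of_inputs` / `holder231_region_of_inputs` / `exists_contour_holder231_region_of_inputs`) and of
r15's **C1.Eq7.3.1-7.3.2** / **C1.Claim@326** (located, cells only): [6]'s (1.11)–(1.12) COVARIANT-DERIVATIVE closeness member
`δ(D_uG_k)(□ ⊆ Ω)` for nested `k`-block unions at a `U(1)` field that is plaquette-small ONLY ON THE PLAQUETTES BASED WITHIN `2L^k` OF `Ω`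
(nothing assumed elsewhere), plus the row-unrestricted forms and the HYPOTHESIS-FREE packages (all four (H1.10″) inputs discharged by p34
gen 20's LOCAL members).  It is p30 g28's `BIJ88NeumannPropagatorSmallFieldCloseDeriv.close112_smallField_deriv_of_inputs` (GLOBAL plaquette
smallness) with exactly two changes: the δG VALUE member it consumes is file C-I's `close112_smoothNear_of_inputs` (local hypothesis; Agmon
bound with the coercivity supplied on `□`-supported fields by gen 16's region Poincaré inequality in gen 20's blockwise gauge), and the centred
axial gauge of the local gradient step is p32's directional gauge `centredGaugeDir` read through gen 20's
`dist1_centredGaugeDir_le_supDist_of_near` (the plaquettes it reads are based within `2r + 2 ≤ 2L^k` of the deep bond's base point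
`y₀ ∈ □ ⊆ Ω`); p30 g29's `…CloseAllRows` / `…CloseRegion` row-extension and packaging re-run on top.  No row is restated and no head changes.
USED BY NAME, never restated: p30's `covD_sub_covD` / `norm_covD_apply` / `nOp_univ_diff_apply_eq_zero` / `exists_depth` / `depth_le_add` /
`mem_of_depth_pos` / `interior_of_depth_two` / `nOp_gaugeAct_mulVec_smul` / `supDist_le_half`; gen 25's `local_gradient_bound` /
`norm_covDiff_gaugeAct` / `gamma_nsq_le_one` (`BIJ85ScalarPropagatorSupDecayDeriv`), `flat_kernel_diffs`; p32's `centredGaugeDir`; p34 gen 20's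
`dist1_centredGaugeDir_le_supDist_of_near` / `decay110_smoothNear_region` / `plaqSmall_near_of_smoothOn` (B-I),
`decay110_smoothNear_region_deriv_uniform` (B-II), gen 21's `close112_smoothNear_of_inputs` (C-I); r18's `SmoothOn`.  p30's PRIVATE kernels
`exp_edge` / `exp_ball` (g28) and `mono_bound` / `mono_bound2` / `shallow_budget` / `threshold_smallness` / `adm_dist_of_shallow` (g29) are
COPIED here as private kernels with attribution (they are not importable / kept below the (2.3x) chain).  Kind: theorems only (no definition,
no `Prop`-valued fact).

WHAT IS PROVED (theorems only; 0 `sorry`; standard axioms).  Objects: p31's region Neumann propagators `G_k(X,u) = gBox (α_kL^{kd}) ε⁻¹ u k X`,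
`X` a union of `k`-blocks (`IsBlockUnion`), `covD ε⁻¹ u φ ⟨x,μ⟩ = ε⁻¹(u_{x,μ}φ(x+e_μ) − φ(x))`, `T(x,y) = |x − y|_∞` (`B5Ineq137Torus.T P 0`).
* §2 **`close112_smoothNear_deriv_of_inputs`** — for `2 ≤ d ≤ 3`, `L` odd `> 1`, `a > 0`, `c₀ ≥ 0`, `δ₀ > 0` there are `c₂, δ₂ > 0` such that
  for every volume, every `1 ≤ k ≤ K`, every region `Ω` and every `U(1)` field `u` with `‖u(∂p) − 1‖ ≤ θ` FOR THE PLAQUETTES BASED WITHIN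
  `2L^k` OF `Ω` (`0 ≤ θ`, `2d³(L^{2k}θ)² ≤ 1`, and the blockwise-gauge threshold `2(L^k−1)L^k·d·T² + 2(d(L^k−1)T)² ≤ ½` at some
  `T ≥ (d−1)(L^k−1)θ` — C-I's hypotheses verbatim), all nested `k`-block unions `□ ⊆ Ω` carrying the two (H1.10″) VALUE members on the
  `□`-rows and the two (H1.10″)-`D` members on the rows `x` with `{T(x,·) < L^k} ⊆ □`, all four at `(c₀, δ₀)` (HYPOTHESES), every row
  `x ∈ □` with `dist_∞(x, T ∖ □) ≥ 14L^k`, every `f` supported in `□` and every `μ`: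
  `‖covD ε⁻¹ u (G_k(□,u)f)⟨x,μ⟩ − covD ε⁻¹ u (G_k(Ω,u)f)⟨x,μ⟩‖ ≤ (L^kε)·c₂e^{−δ₂D/L^k}e^{−δ₂(D_b + D_f)/L^k}·F`;
* §3 **`close112_smoothNear_deriv_of_inputs_ballRows`** (rows with `L^k ≤ T(x,w)` for all `w ∉ □`) and **`close112_smoothNear_of_inputs_allRows`**
  (C-I's VALUE member at EVERY row `x ∈ □`) — p30 g29's row extensions re-run;
* §4 **`inputs110_smoothNear_region`** (the four (H1.10″) inputs + the two thresholds for nested block unions `□ ⊆ Ω` from `(L^{2k}θ)² ≤ 1/500`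
  and plaquette smallness NEAR `Ω` ONLY: B-I `decay110_smoothNear_region` ×2, B-II `decay110_smoothNear_region_deriv_uniform` ×2 — a cube's
  neighbourhood lies in `Ω`'s), **`close112_smoothNear_region`** (value, every row, hypothesis-free), **`close112_smoothNear_region_deriv`**
  (covariant derivative, ball rows, hypothesis-free);
* §5 **`close112_smoothOn_region`**, **`close112_smoothOn_region_deriv`** — §4 UNDER THE PRINTED (2.32): r18's `SmoothOn e_k η C 𝓅 X B Pl (cfg u)`
  with `Pl ⊇` the plaquettes based within `2L^k` of `Ω`, `B ⊇` their bonds, threshold `(L^{2k}·e_kη²C𝓅)² ≤ 1/500`.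
HONEST SCOPE / DIVERGENCE.  (i) Hypothesis LOCAL as printed, in the tree's currency (plaquette smallness within sup-distance `2L^k` of `Ω`; a
vortex in a hole of `Ω` is allowed); (2.32) via `SmoothOn` with the clause `|∂*A|` and the site set unused.  (ii)–(v) of p30 g28/g29 otherwise
verbatim: `U(1)` only, `2 ≤ d ≤ 3`, `L` odd `> 1`, `1 ≤ k ≤ K`; rows at sup-depth `≥ 14L^k` (§2) resp. `≥ L^k` (§3–§5) — [6]'s *"with the same
restrictions on x"* with OUR `R₀`; the Hölder member of the clause is p27's lane; constants explicit, depending on `(d, L, a, c₀, δ₀)` only.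
DIVERGENCE OF METHOD as disclosed by p30 (local interior gradient estimate + weighted maximum principle instead of [6]'s random walk).
Literature + Mathlib only.  Nothing here is summit progress, continuum or Clay.  Unit `lit-balaban-p34` (literature-prover-lit-balaban-p34-g21-0),
HOME `run/shared/lean/pub/lit-balaban/`, 2026-08-23.
-/

open scoped BigOperators ComplexConjugate
open Finset Matrix

namespace Literature.MathematicalPhysics.QuantumFieldTheory.BalabanImbrieJaffe1984to88.BIJ88NeumannPropagatorSmoothNearCloseDeriv

open Literature.MathematicalPhysics.QuantumFieldTheory.Balaban1983to89
open LatticeFieldCalculus (supDist)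
open B3TorusRadialSums (supDist_comm supDist_eq_zero_iff)
open BIJ85Ineq722Torus (supDist_triangle)
open BIJ88Sect3Statements (U1 toC cfg covD norm_toC toC_one)
open BIJ88Sect2Statements (SmoothOn)
open GaugeField (plaqHol)
open BIJ88NeumannNoZeroModesTorus (IsBlockUnion)
open BIJ88NeumannPropagator227Torus (nOp gBox)
open BIJ85ScalarPropagatorSupDecayDeriv (local_gradient_bound norm_covDiff_gaugeAct gamma_nsq_le_one)
open BIJ85TorusTentCutoff (supDist_shift_le_one')
open BIJ85FlatPropagatorKernelDiffs (flat_kernel_diffs)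
open BIJ85BiCentredAxialGauge (centredGaugeDir)
open BIJ88Smooth43Axial (dist1_eq_norm_toC_sub_one)
open BIJ88NeumannPropagatorSmallFieldClose (nOp_univ_diff_apply_eq_zero exists_depth depth_le_add mem_of_depth_pos interior_of_depth_two
  nOp_gaugeAct_mulVec_smul supDist_le_half)
open BIJ88NeumannPropagatorSmallFieldCloseDeriv (covD_sub_covD norm_covD_apply)
open BIJ88NeumannPropagatorSmoothNearRegion (dist1_centredGaugeDir_le_supDist_of_near decay110_smoothNear_region plaqSmall_near_of_smoothOn)
open BIJ88NeumannPropagatorSmoothNearRegionHolder (decay110_smoothNear_region_deriv_uniform)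
open BIJ88NeumannPropagatorSmoothNearClose (close112_smoothNear_of_inputs)

noncomputable section

variable {P : Params}

/-! ## §1 Kernel lemmas (private copies of p30's kernels, with attribution) -/

/-- kernel (p30 g28's `exp_edge`, copied): **the edge-alternative exponent** — with `0 ≤ t`, `2t ≤ δ₀`, `0 ≤ A`, `Df ≤ A + δ`, `δ ≤ 14n`,
`0 < n`: `e^{−δ₀A/n} ≤ e^{28t}·e^{−t(A+δ)/n}·e^{−tDf/n}`. [folklore] -/
private theorem exp_edge {n t δ₀ A δ Df : ℝ} (hn : 0 < n) (ht : 0 ≤ t) (htδ : 2 * t ≤ δ₀) (hA : 0 ≤ A) (hDf : Df ≤ A + δ)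
    (hδ : δ ≤ 14 * n) :
    Real.exp (-(δ₀ * A / n)) ≤ Real.exp (28 * t) * Real.exp (-(t * (A + δ) / n)) * Real.exp (-(t * Df / n)) := by
  rw [← Real.exp_add, ← Real.exp_add]
  refine Real.exp_le_exp.2 ?_
  rw [show 28 * t + -(t * (A + δ) / n) + -(t * Df / n) = (28 * t * n - t * (A + δ) - t * Df) / n by field_simp; ring,
    show -(δ₀ * A / n) = (-(δ₀ * A)) / n by ring]
  refine div_le_div_of_nonneg_right ?_ hn.le
  nlinarith [mul_le_mul_of_nonneg_left hDf ht, mul_le_mul_of_nonneg_left hδ ht, mul_nonneg ht hA]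

/-- kernel (p30 g28's `exp_ball`, copied): **slack of the weight over a ball** — with `0 ≤ t ≤ 1`, `A₀ ≤ s + A`, `δ₀' ≤ δ + s`, `2s ≤ n`,
`0 < n`: `e^{−t(A+δ)/n} ≤ e^{−t(A₀+δ₀')/n}·e`. [folklore] -/
private theorem exp_ball {n t A δ A₀ δ₀' s : ℝ} (hn : 0 < n) (ht : 0 ≤ t) (ht1 : t ≤ 1) (hs0 : 0 ≤ s) (hA : A₀ ≤ s + A)
    (hδ : δ₀' ≤ δ + s) (hs : 2 * s ≤ n) :
    Real.exp (-(t * (A + δ) / n)) ≤ Real.exp (-(t * (A₀ + δ₀') / n)) * Real.exp 1 := by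
  rw [← Real.exp_add]
  refine Real.exp_le_exp.2 ?_
  rw [show -(t * (A₀ + δ₀') / n) + 1 = (-(t * (A₀ + δ₀')) + n) / n by field_simp, show -(t * (A + δ) / n) = (-(t * (A + δ))) / n by ring]
  refine div_le_div_of_nonneg_right ?_ hn.le
  have h1 := mul_le_mul_of_nonneg_left hA ht
  have h2 := mul_le_mul_of_nonneg_left hδ ht
  have h3 : t * (2 * s) ≤ 1 * (2 * s) := mul_le_mul_of_nonneg_right ht1 (by linarith)
  linarith

/-- kernel (p30 g29's `mono_bound2`, copied): weakening the constants of a two-factor decay bound, `c ≤ c′`, `δ′ ≤ δ`, `E₁, E₂, F ≥ 0`: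
`c·e^{−δE₁}·e^{−δE₂}·F ≤ c′·e^{−δ′E₁}·e^{−δ′E₂}·F`. [folklore] -/
private theorem mono_bound2 {c c' δ δ' E₁ E₂ F : ℝ} (hc : 0 ≤ c) (hcc : c ≤ c') (hδ : δ' ≤ δ) (hE₁ : 0 ≤ E₁) (hE₂ : 0 ≤ E₂)
    (hF : 0 ≤ F) :
    c * Real.exp (-(δ * E₁)) * Real.exp (-(δ * E₂)) * F ≤ c' * Real.exp (-(δ' * E₁)) * Real.exp (-(δ' * E₂)) * F := by
  have h1 : Real.exp (-(δ * E₁)) ≤ Real.exp (-(δ' * E₁)) := Real.exp_le_exp.2 (neg_le_neg (mul_le_mul_of_nonneg_right hδ hE₁))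
  have h2 : Real.exp (-(δ * E₂)) ≤ Real.exp (-(δ' * E₂)) := Real.exp_le_exp.2 (neg_le_neg (mul_le_mul_of_nonneg_right hδ hE₂))
  have h3 : c * Real.exp (-(δ * E₁)) ≤ c' * Real.exp (-(δ' * E₁)) := mul_le_mul hcc h1 (Real.exp_pos _).le (hc.trans hcc)
  exact mul_le_mul_of_nonneg_right (mul_le_mul h3 h2 (Real.exp_pos _).le (mul_nonneg (hc.trans hcc) (Real.exp_pos _).le)) hF

/-- kernel (p30 g29's `mono_bound`, copied): weakening the constants of a one-factor decay bound, `c ≤ c′`, `δ′ ≤ δ`, `E, F ≥ 0`: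
`c·e^{−δE}·F ≤ c′·e^{−δ′E}·F`. [folklore] -/
private theorem mono_bound {c c' δ δ' E F : ℝ} (hc : 0 ≤ c) (hcc : c ≤ c') (hδ : δ' ≤ δ) (hE : 0 ≤ E) (hF : 0 ≤ F) :
    c * Real.exp (-(δ * E)) * F ≤ c' * Real.exp (-(δ' * E)) * F :=
  mul_le_mul_of_nonneg_right (mul_le_mul hcc (Real.exp_le_exp.2 (neg_le_neg (mul_le_mul_of_nonneg_right hδ hE))) (Real.exp_pos _).le
    (hc.trans hcc)) hF

/-- kernel (p30 g29's `shallow_budget`, copied), **THE SHALLOW-ROW EXPONENT BUDGET**: if `0 ≤ D ≤ D″`, `D_f ≤ D″ + Rn`, `D_b ≤ Rn`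
(`n = L^k > 0`, `δ₀ ≥ 0`), then `e^{−δ₀D″/n} ≤ e^{Rδ₀}·e^{−(δ₀/2)D/n}·e^{−(δ₀/2)(D_b + D_f)/n}`. [folklore] -/
private theorem shallow_budget {n R δ₀ D D'' Db Df : ℝ} (hn : 0 < n) (hδ₀ : 0 ≤ δ₀) (hDD : D ≤ D'')
    (hDf : Df ≤ D'' + R * n) (hDb : Db ≤ R * n) :
    Real.exp (-(δ₀ * (n⁻¹ * D''))) ≤
      Real.exp (R * δ₀) * Real.exp (-(δ₀ / 2 * (n⁻¹ * D))) * Real.exp (-(δ₀ / 2 * (n⁻¹ * (Db + Df)))) := by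
  rw [← Real.exp_add, ← Real.exp_add]
  refine Real.exp_le_exp.2 ?_
  have hm : 0 ≤ n⁻¹ := (inv_pos.2 hn).le
  have hδ2 : 0 ≤ δ₀ / 2 := by linarith
  have hsum : D + Db + Df ≤ 2 * D'' + 2 * (R * n) := by linarith
  have h1 : δ₀ / 2 * (n⁻¹ * (D + Db + Df)) ≤ δ₀ / 2 * (n⁻¹ * (2 * D'' + 2 * (R * n))) :=
    mul_le_mul_of_nonneg_left (mul_le_mul_of_nonneg_left hsum hm) hδ2
  have hinv : n⁻¹ * n = 1 := inv_mul_cancel₀ hn.ne'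
  have h2 : δ₀ / 2 * (n⁻¹ * (2 * D'' + 2 * (R * n))) = δ₀ * (n⁻¹ * D'') + R * δ₀ := by
    linear_combination (δ₀ * R) * hinv
  have h3 : δ₀ / 2 * (n⁻¹ * (D + Db + Df)) = δ₀ / 2 * (n⁻¹ * D) + δ₀ / 2 * (n⁻¹ * (Db + Df)) := by ring
  linarith

/-- kernel (p30 g29's `threshold_smallness`, copied; the statement of record is p31's `BIJ88DeltaLocSmallPlaquetteTorusCwt.smallness_of_threshold`,
kept out of the imports of this propagator-level file): `(L^{2k}θ)² ≤ 1/500` implies, for `1 ≤ d′ ≤ 3`, `2d′³(L^{2k}θ)² ≤ 1` and, with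
`T = (d′−1)(L^k−1)θ`, `2(L^k−1)L^k·d′·T² + 2(d′(L^k−1)T)² ≤ ½`. [cite: BalabanImbrieJaffe1985, (7.3.1) p.326] -/
private theorem threshold_smallness {dr n θ : ℝ} (hd1 : 1 ≤ dr) (hd3 : dr ≤ 3) (hn : 1 ≤ n) (hθ : 0 ≤ θ)
    (hτ : (n ^ 2 * θ) ^ 2 ≤ 1 / 500) :
    2 * dr ^ 3 * (n ^ 2 * θ) ^ 2 ≤ 1 ∧
      2 * ((n - 1) * n) * dr * ((dr - 1) * (n - 1) * θ) ^ 2 + 2 * (dr * (n - 1) * ((dr - 1) * (n - 1) * θ)) ^ 2 ≤ 1 / 2 := by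
  have hd0 : 0 ≤ dr := by linarith
  have hn0 : 0 ≤ n := by linarith
  have hd27 : dr ^ 3 ≤ 27 := by
    have h := pow_le_pow_left₀ hd0 hd3 3
    norm_num at h
    exact h
  have hd81 : dr ^ 4 ≤ 81 := by
    have h := pow_le_pow_left₀ hd0 hd3 4
    norm_num at h
    exact h
  have hτ0 : 0 ≤ (n ^ 2 * θ) ^ 2 := sq_nonneg _
  refine ⟨?_, ?_⟩
  · calc 2 * dr ^ 3 * (n ^ 2 * θ) ^ 2 ≤ 2 * 27 * (1 / 500) :=
          mul_le_mul (mul_le_mul_of_nonneg_left hd27 (by norm_num)) hτ hτ0 (by norm_num)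
      _ ≤ 1 := by norm_num
  · have hn1 : n - 1 ≤ n := by linarith
    have hdr1 : dr - 1 ≤ dr := by linarith
    have hn10 : 0 ≤ n - 1 := by linarith
    have hdr10 : 0 ≤ dr - 1 := by linarith
    calc 2 * ((n - 1) * n) * dr * ((dr - 1) * (n - 1) * θ) ^ 2 + 2 * (dr * (n - 1) * ((dr - 1) * (n - 1) * θ)) ^ 2
        ≤ 2 * (n * n) * dr * (dr * n * θ) ^ 2 + 2 * (dr * n * (dr * n * θ)) ^ 2 := by gcongr
      _ = (2 * dr ^ 3 + 2 * dr ^ 4) * (n ^ 2 * θ) ^ 2 := by ring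
      _ ≤ (2 * 27 + 2 * 81) * (1 / 500) := mul_le_mul (by linarith) hτ hτ0 (by norm_num)
      _ ≤ 1 / 2 := by norm_num

/-- kernel (p30 g29's `adm_dist_of_shallow`, copied), **THE ADMISSIBLE DISTANCE AT A SHALLOW ROW**: if `w₀ ∉ □` with `T(x, w₀) < Rn` and
`D ≤ T(x,y)`, `D_f ≤ T(y,w)` for all `y ∈ supp f`, `w ∉ □`, then `max(D, D_f − Rn) ≤ T(x, y)` for every `y ∈ supp f`.
[cite: Balaban1983RegularityDecay, Theorem p.573 (1.12)] -/
private theorem adm_dist_of_shallow {B : Finset (Balaban1983to89.Site P 0)} {x w₀ : Balaban1983to89.Site P 0} (hw₀ : w₀ ∉ B)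
    {Rn D Df : ℝ} (hlt : B5Ineq137Torus.T P 0 x w₀ < Rn) {f : Balaban1983to89.Site P 0 → ℂ}
    (hsD : ∀ y, f y ≠ 0 → D ≤ B5Ineq137Torus.T P 0 x y) (hsDf : ∀ y, f y ≠ 0 → ∀ w, w ∉ B → Df ≤ B5Ineq137Torus.T P 0 y w) :
    ∀ y, f y ≠ 0 → max D (Df - Rn) ≤ B5Ineq137Torus.T P 0 x y := by
  intro y hy
  refine max_le (hsD y hy) ?_
  have h1 := hsDf y hy w₀ hw₀
  have h2 : B5Ineq137Torus.T P 0 y w₀ ≤ B5Ineq137Torus.T P 0 x y + B5Ineq137Torus.T P 0 x w₀ := by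
    rw [B3Bound323ZeroTorus.T_eq_supDist, B3Bound323ZeroTorus.T_eq_supDist, B3Bound323ZeroTorus.T_eq_supDist, supDist_comm x y]
    exact_mod_cast supDist_triangle y x w₀
  linarith

section Main

/-! ## §2 The covariant-derivative member of (1.11)–(1.12) at a field plaquette-small NEAR `Ω` only -/

set_option maxHeartbeats 800000 in
/-- **[Balaban1983RegularityDecay] THEOREM p. 573, (1.11)–(1.12) — THE `δG_k(□,Ω)` COVARIANT-DERIVATIVE MEMBER, `k`-UNIFORM, OPERATOR FORM, AT A
`U(1)` FIELD PLAQUETTE-SMALL NEAR `Ω` ONLY** ([BalabanImbrieJaffe1988] p. 263: *"for (2.31) we assume smoothness throughout the subset Ω ⊂ T_η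
… Bounds analogous to (2.30), (2.31) hold for covariant derivatives"*; [I] p. 326: *"by change of gauge u_k can be transformed in a local region
Λ into a configuration of the form exp[ie_kηA], where A is smooth and small"*): p30 g28's `close112_smallField_deriv_of_inputs` with the
GLOBAL hypothesis `∀ p, ‖u(∂p) − 1‖ ≤ θ` replaced by the LOCAL one — `‖u(∂p) − 1‖ ≤ θ` for the plaquettes `p` based within sup-distance `2L^k`
of `Ω` (`0 ≤ θ`, `2d³(L^{2k}θ)² ≤ 1`, and the blockwise-gauge threshold of C-I at some `T ≥ (d−1)(L^k−1)θ`).  For `2 ≤ d ≤ 3`, `L` odd `> 1`,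
`a > 0`, `c₀ ≥ 0`, `δ₀ > 0` there are `c₂, δ₂ > 0` (depending on these only) such that: for every volume, every `1 ≤ k ≤ K`, all nested
`k`-block unions `□ ⊆ Ω` carrying the (H1.10″) VALUE members of `G_k(□,u)`, `G_k(Ω,u)` on the rows of `□` and their (H1.10″) covariant-derivative
members on the rows `x` with `{|x − ·|_∞ < L^k} ⊆ □` (four HYPOTHESES at `(c₀, δ₀)`), every `x ∈ □` with `dist_∞(x, T ∖ □) ≥ 14L^k`, every `f`
supported in `□` (`‖f‖_∞ ≤ F`, `D ≤ dist(x, supp f)`, `D_b ≤ dist(x, □^c)`, `D_f ≤ dist(supp f, □^c)`) and every `μ`: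
`‖covD ε⁻¹ u (G_k(□,u)f) ⟨x,μ⟩ − covD ε⁻¹ u (G_k(Ω,u)f) ⟨x,μ⟩‖ ≤ (L^kε)·c₂e^{−δ₂D/L^k}e^{−δ₂(D_b+D_f)/L^k}F`.  METHOD: p30's proof VERBATIM
(weighted maximum over the deep bonds, gen 25's `local_gradient_bound` at the maximal bond, absorption), with the values from C-I's
`close112_smoothNear_of_inputs` and the gauge `centredGaugeDir u y₀ (2r) μ₀`, whose bond bound `‖u′ − 1‖ ≤ (d−1)θ|y₀ − ·|_∞` on the `2r`-ball
needs only the plaquettes based within `2r + 2 ≤ 2L^k` of `y₀ ∈ □ ⊆ Ω` (gen 20's `dist1_centredGaugeDir_le_supDist_of_near`).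
[cite: Balaban1983RegularityDecay, Theorem p.573 (1.10)–(1.12)] [cite: BalabanImbrieJaffe1985, (7.3.1)–(7.3.2) p.326]
[cite: BalabanImbrieJaffe1988, (2.31)–(2.32) p.263] -/
theorem close112_smoothNear_deriv_of_inputs (d L : ℕ) (hd : 2 ≤ d) (hd3 : d ≤ 3) (hL : Odd L ∧ 1 < L) {a : ℝ} (ha : 0 < a)
    {c₀ δ₀ : ℝ} (hc₀ : 0 ≤ c₀) (hδ₀ : 0 < δ₀) :
    ∃ c₂ δ₂ : ℝ, 0 < c₂ ∧ 0 < δ₂ ∧ ∀ (P : Params), P.d = d → P.L = L → ∀ k : ℕ, 1 ≤ k → k ≤ P.K →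
      ∀ (U : GaugeField P 0 U1) (Ω : Finset (Balaban1983to89.Site P 0)) (θ : ℝ), 0 ≤ θ →
      (∀ p : Balaban1983to89.Plaq P 0, (∃ y ∈ Ω, supDist y p.src ≤ 2 * P.L ^ k) → ‖toC (plaqHol U p) - 1‖ ≤ θ) →
      2 * (P.d : ℝ) ^ 3 * (((P.L : ℝ) ^ k) ^ 2 * θ) ^ 2 ≤ 1 →
      ∀ (T : ℝ), ((P.d - 1 : ℕ) : ℝ) * ((P.L : ℝ) ^ k - 1) * θ ≤ T →
        2 * (((P.L : ℝ) ^ k - 1) * (P.L : ℝ) ^ k) * P.d * T ^ 2 + 2 * (P.d * ((P.L : ℝ) ^ k - 1) * T) ^ 2 ≤ 1 / 2 →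
      ∀ (B : Finset (Balaban1983to89.Site P 0)), IsBlockUnion k B → IsBlockUnion k Ω → B ⊆ Ω →
      (∀ x ∈ B, ∀ (f : Balaban1983to89.Site P 0 → ℂ) (F D : ℝ), (∀ y, ‖f y‖ ≤ F) → 0 ≤ D →
          (∀ y, f y ≠ 0 → D ≤ B5Ineq137Torus.T P 0 x y) →
          ‖(gBox (B1RG242Torus.α P a k * (P.L : ℝ) ^ (k * P.d)) P.eps⁻¹ U k B *ᵥ f) x‖ ≤
            P.spacing k ^ 2 * (c₀ * Real.exp (-(δ₀ * (((P.L : ℝ) ^ k)⁻¹ * D))) * F)) →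
      (∀ x ∈ B, ∀ (f : Balaban1983to89.Site P 0 → ℂ) (F D : ℝ), (∀ y, ‖f y‖ ≤ F) → 0 ≤ D →
          (∀ y, f y ≠ 0 → D ≤ B5Ineq137Torus.T P 0 x y) →
          ‖(gBox (B1RG242Torus.α P a k * (P.L : ℝ) ^ (k * P.d)) P.eps⁻¹ U k Ω *ᵥ f) x‖ ≤
            P.spacing k ^ 2 * (c₀ * Real.exp (-(δ₀ * (((P.L : ℝ) ^ k)⁻¹ * D))) * F)) →
      (∀ x, (∀ y, B5Ineq137Torus.T P 0 x y < (P.L : ℝ) ^ k → y ∈ B) →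
          ∀ (f : Balaban1983to89.Site P 0 → ℂ) (F D : ℝ), (∀ y, ‖f y‖ ≤ F) → 0 ≤ D →
          (∀ y, f y ≠ 0 → D ≤ B5Ineq137Torus.T P 0 x y) → ∀ (μ : Fin P.d),
          ‖covD P.eps⁻¹ (cfg U) (gBox (B1RG242Torus.α P a k * (P.L : ℝ) ^ (k * P.d)) P.eps⁻¹ U k B *ᵥ f) ⟨x, μ⟩‖ ≤
            P.spacing k * (c₀ * Real.exp (-(δ₀ * (((P.L : ℝ) ^ k)⁻¹ * D))) * F)) →
      (∀ x, (∀ y, B5Ineq137Torus.T P 0 x y < (P.L : ℝ) ^ k → y ∈ B) →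
          ∀ (f : Balaban1983to89.Site P 0 → ℂ) (F D : ℝ), (∀ y, ‖f y‖ ≤ F) → 0 ≤ D →
          (∀ y, f y ≠ 0 → D ≤ B5Ineq137Torus.T P 0 x y) → ∀ (μ : Fin P.d),
          ‖covD P.eps⁻¹ (cfg U) (gBox (B1RG242Torus.α P a k * (P.L : ℝ) ^ (k * P.d)) P.eps⁻¹ U k Ω *ᵥ f) ⟨x, μ⟩‖ ≤
            P.spacing k * (c₀ * Real.exp (-(δ₀ * (((P.L : ℝ) ^ k)⁻¹ * D))) * F)) →
      ∀ x ∈ B, (∀ w, w ∉ B → 14 * (P.L : ℝ) ^ k ≤ B5Ineq137Torus.T P 0 x w) →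
      ∀ (f : Balaban1983to89.Site P 0 → ℂ) (F D Db Df : ℝ), (∀ y, ‖f y‖ ≤ F) → (∀ y, y ∉ B → f y = 0) →
        0 ≤ D → (∀ y, f y ≠ 0 → D ≤ B5Ineq137Torus.T P 0 x y) → 0 ≤ Db → (∀ w, w ∉ B → Db ≤ B5Ineq137Torus.T P 0 x w) →
        0 ≤ Df → (∀ y, f y ≠ 0 → ∀ w, w ∉ B → Df ≤ B5Ineq137Torus.T P 0 y w) → ∀ (μ : Fin P.d),
        ‖covD P.eps⁻¹ (cfg U) (gBox (B1RG242Torus.α P a k * (P.L : ℝ) ^ (k * P.d)) P.eps⁻¹ U k B *ᵥ f) ⟨x, μ⟩ -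
            covD P.eps⁻¹ (cfg U) (gBox (B1RG242Torus.α P a k * (P.L : ℝ) ^ (k * P.d)) P.eps⁻¹ U k Ω *ᵥ f) ⟨x, μ⟩‖ ≤
          P.spacing k * (c₂ * Real.exp (-(δ₂ * (((P.L : ℝ) ^ k)⁻¹ * D))) *
            Real.exp (-(δ₂ * (((P.L : ℝ) ^ k)⁻¹ * (Db + Df)))) * F) := by
  classical
  obtain ⟨c₁, δ₁, hc₁, hδ₁, hval⟩ := close112_smoothNear_of_inputs d L hd hd3 hL ha hc₀ hδ₀
  obtain ⟨C_K, hCK, hker⟩ := flat_kernel_diffs d L hd hL ha (le_refl (0 : ℝ))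
  obtain ⟨C_L, hCL, hloc⟩ := local_gradient_bound d (by omega) C_K hCK.le
  -- the rate, the ball fraction and the constant
  set t : ℝ := min (min δ₁ (δ₀ / 2)) 1 with htdef
  have ht : 0 < t := lt_min (lt_min hδ₁ (by linarith)) one_pos
  have ht1 : t ≤ 1 := min_le_right _ _
  have htδ₁ : t ≤ δ₁ := (min_le_left _ _).trans (min_le_left _ _)
  have htδ₀ : 2 * t ≤ δ₀ := by
    have h1 : t ≤ min δ₁ (δ₀ / 2) := min_le_left _ _
    have h2 : min δ₁ (δ₀ / 2) ≤ δ₀ / 2 := min_le_right _ _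
    linarith
  set e : ℝ := Real.exp 1 with hedef
  have he1 : 1 ≤ e := by rw [hedef]; exact Real.one_le_exp (by norm_num)
  have he0 : 0 < e := Real.exp_pos 1
  set c : ℝ := min (1 / 8) (1 / (2 * (C_L * e + 1))) with hcdef
  have hc0 : 0 < c := lt_min (by norm_num) (by positivity)
  have hc8 : c ≤ 1 / 8 := min_le_left _ _
  have hc1 : c ≤ 1 := hc8.trans (by norm_num)
  have hcC : C_L * e * c ≤ 1 / 2 := by
    have h1 : c ≤ 1 / (2 * (C_L * e + 1)) := min_le_right _ _
    have h2 : 0 ≤ C_L * e := by positivity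
    calc C_L * e * c ≤ C_L * e * (1 / (2 * (C_L * e + 1))) := mul_le_mul_of_nonneg_left h1 h2
      _ ≤ 1 / 2 := by rw [mul_one_div, div_le_iff₀ (by positivity)]; linarith
  set K₁ : ℝ := c₁ * Real.exp 6 * (c + 2 / c + 2 * a) with hK₁
  have hK₁0 : 0 ≤ K₁ := by positivity
  refine ⟨2 * C_L * K₁ + 2 * Real.exp 29 * c₀ + 8 * e ^ 2 * c₁ / c + 1, t, by positivity, ht, ?_⟩
  intro P hPd hPL k hk1 hkK U Ω θ hθ0 hplaq hsmall Tb hTb hsmallTb B hB hΩ hsub hGB hGΩ hDB hDΩ x hxB hdeep f F D Db Df hF hfB hD hsD hDb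
    hsDb hDf hsDf μ
  have hvalP := hval P hPd hPL k hk1 hkK U Ω θ hθ0 hplaq hsmall Tb hTb hsmallTb B hB hΩ hsub hGB hGΩ
  have hkerP := hker P hPd hPL k hk1 hkK
  subst hPd
  -- basic quantities
  have hd1 : 1 ≤ P.d := by omega
  have hk : k ≤ P.m + P.K := hkK.trans (Nat.le_add_left _ _)
  have hk0 : 0 + k ≤ P.m + P.K := by omega
  have hLpos : (0 : ℝ) < P.L := P.cast_L_pos
  have hL1 : (1 : ℝ) < P.L := B1RG242Torus.one_lt_cast_L P
  have hε : 0 < P.eps := P.eps_pos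
  set n : ℝ := (P.L : ℝ) ^ k with hndef
  have hn : 0 < n := pow_pos hLpos k
  have hn1 : 1 ≤ n := one_le_pow₀ hL1.le
  have hncast : ((P.L ^ k : ℕ) : ℝ) = n := by rw [hndef]; exact Nat.cast_pow P.L k
  have hsp : P.spacing k = n * P.eps := rfl
  have hsp0 : 0 < P.spacing k := P.spacing_pos k
  have hα : 0 < B1RG242Torus.α P a k := mul_pos (B1.aSeq_pos ha hL1 hk1) (inv_pos.2 (pow_pos hsp0 2))
  have hαa : B1RG242Torus.α P a k * P.spacing k ^ 2 ≤ a := by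
    show B1.aSeq a P.L k * (P.spacing k ^ 2)⁻¹ * P.spacing k ^ 2 ≤ a
    rw [inv_mul_cancel_right₀ (pow_ne_zero 2 hsp0.ne')]
    exact B1.aSeq_le ha hL1 k hk1
  set a' : ℝ := B1RG242Torus.α P a k * (P.L : ℝ) ^ (k * P.d) with ha'def
  have ha' : 0 < a' := mul_pos hα (pow_pos hLpos _)
  have hc' : P.eps⁻¹ ≠ 0 := inv_ne_zero hε.ne'
  have hF0 : 0 ≤ F := (norm_nonneg _).trans (hF x)
  have hT : ∀ y z : Balaban1983to89.Site P 0, B5Ineq137Torus.T P 0 y z = (supDist y z : ℝ) :=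
    fun y z => B3Bound323ZeroTorus.T_eq_supDist P y z
  -- the function `v` and the target
  set v : Balaban1983to89.Site P 0 → ℂ := fun y => (gBox a' P.eps⁻¹ U k B *ᵥ f) y - (gBox a' P.eps⁻¹ U k Ω *ᵥ f) y with hv
  set X : ℝ := Real.exp (-(t * Df / n)) with hXdef
  have hX0 : 0 < X := Real.exp_pos _
  have hX1 : X ≤ 1 := by rw [hXdef]; exact Real.exp_le_one_iff.2 (by rw [neg_nonpos]; positivity)
  have hexpD : ∀ {D₁ D₂ : ℝ}, D₂ ≤ D₁ → Real.exp (-(t * D₁ / n)) ≤ Real.exp (-(t * D₂ / n)) := fun h =>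
    Real.exp_le_exp.2 (by rw [neg_le_neg_iff]; exact div_le_div_of_nonneg_right (mul_le_mul_of_nonneg_left h ht.le) hn.le)
  have hexp_δ₁ : ∀ {D' : ℝ}, 0 ≤ D' → Real.exp (-(δ₁ * (n⁻¹ * D'))) ≤ Real.exp (-(t * D' / n)) := fun {D'} hD' => by
    refine Real.exp_le_exp.2 ?_
    rw [show δ₁ * (n⁻¹ * D') = δ₁ * D' / n by ring, neg_le_neg_iff]
    exact div_le_div_of_nonneg_right (mul_le_mul_of_nonneg_right htδ₁ hD') hn.le
  have hgoal : ‖covD P.eps⁻¹ (cfg U) (gBox a' P.eps⁻¹ U k B *ᵥ f) ⟨x, μ⟩ - covD P.eps⁻¹ (cfg U) (gBox a' P.eps⁻¹ U k Ω *ᵥ f) ⟨x, μ⟩‖ =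
      P.eps⁻¹ * ‖cfg U ⟨x, μ⟩ * v (x.shift μ) - v x‖ := by
    rw [covD_sub_covD, norm_mul, Complex.norm_real, Real.norm_of_nonneg (inv_nonneg.2 hε.le)]
  rw [hgoal, show t * (n⁻¹ * D) = t * D / n by ring, show t * (n⁻¹ * (Db + Df)) = t * Db / n + t * Df / n by ring, neg_add,
    Real.exp_add, ← hXdef]
  set c₂ : ℝ := 2 * C_L * K₁ + 2 * Real.exp 29 * c₀ + 8 * e ^ 2 * c₁ / c + 1 with hc₂def
  have hc₂a : 2 * C_L * K₁ + 2 * Real.exp 29 * c₀ ≤ c₂ := by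
    rw [hc₂def]; linarith [show (0 : ℝ) ≤ 8 * e ^ 2 * c₁ / c by positivity]
  have hc₂b : 8 * e ^ 2 * c₁ / c ≤ c₂ := by
    rw [hc₂def]; linarith [show (0 : ℝ) ≤ 2 * C_L * K₁ + 2 * Real.exp 29 * c₀ by positivity]
  -- the trivial case `□ = T`
  by_cases hBT : B = univ
  · have hΩT : Ω = univ := Finset.eq_univ_of_forall fun y => hsub (hBT ▸ mem_univ y)
    have h0 : ∀ y, v y = 0 := fun y => by
      show (gBox _ _ U k B *ᵥ f) y - (gBox _ _ U k Ω *ᵥ f) y = 0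
      rw [hBT, hΩT, sub_self]
    rw [h0, h0, mul_zero, sub_zero, norm_zero, mul_zero]; positivity
  -- the depth function; the row `x` is deep; the torus is large
  obtain ⟨δB, h1, h2⟩ := exists_depth hBT
  obtain ⟨w₀, hw₀, hδx⟩ := h2 x
  have hδx14 : 14 * P.L ^ k ≤ δB x := by
    have hh := hdeep w₀ hw₀
    rw [hT, ← hδx] at hh
    have h3 : ((14 * P.L ^ k : ℕ) : ℝ) ≤ ((δB x : ℕ) : ℝ) := by push_cast; linarith [hh, hndef]
    exact_mod_cast h3
  have hNbig : 28 * P.L ^ k ≤ P.sitesPerDir 0 := by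
    have h3 := supDist_le_half x w₀
    rw [← hδx] at h3
    omega
  have hr1L : 1 ≤ P.L ^ k := Nat.one_le_pow _ _ P.L_pos
  -- harmonicity of `v` at depth `≥ 2`
  have hharm : ∀ y, 2 ≤ δB y → (nOp a' P.eps⁻¹ U k univ *ᵥ v) y = 0 := by
    intro y hy
    obtain ⟨hyB, hs, hu⟩ := interior_of_depth_two h1 h2 hy
    exact nOp_univ_diff_apply_eq_zero hk0 hc' ha' U hB hΩ hsub f hyB hs hu
  -- `dist(supp f, □^c) ≤ dist(z, supp f) + depth(z)` in the form used below, and the depth from `hdeep`-type data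
  have hDf_edge : ∀ (z y : Balaban1983to89.Site P 0), f y ≠ 0 → Df ≤ (supDist z y : ℝ) + δB z := by
    intro z y hy
    obtain ⟨w, hw, hzw⟩ := h2 z
    have := hsDf y hy w hw
    rw [hT] at this
    have htri : supDist y w ≤ supDist y z + supDist z w := supDist_triangle y z w
    have hc : ((supDist y w : ℕ) : ℝ) ≤ ((supDist y z + supDist z w : ℕ) : ℝ) := by exact_mod_cast htri
    push_cast at hc
    rw [supDist_comm y z, ← hzw] at hc
    linarith
  -- THE VALUE MEMBER near a deep row: for `z` with `|y₀ − z|_∞ ≤ s`, `depth(y₀) ≥ 14L^k`, `s ≤ 4L^k`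
  have hvalue : ∀ (y₀ z : Balaban1983to89.Site P 0) (s : ℕ), 14 * P.L ^ k ≤ δB y₀ → supDist y₀ z ≤ s → s ≤ 4 * P.L ^ k →
      ∀ A₀ : ℝ, (∀ y, f y ≠ 0 → A₀ ≤ (supDist y₀ y : ℝ)) →
      ‖v z‖ ≤ c₁ * P.spacing k ^ 2 * F * (Real.exp (-(t * (A₀ - s) / n)) * Real.exp (-(t * ((δB y₀ : ℝ) - s) / n))) * X := by
    intro y₀ z s hy₀ hz hs A₀ hA₀
    have hzB : z ∈ B := mem_of_depth_pos h1 (by have := depth_le_add h1 h2 y₀ z; omega)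
    have hz10 : ∀ w, w ∉ B → 10 * n ≤ B5Ineq137Torus.T P 0 z w := by
      intro w hw
      have h3 := h1 y₀ w hw
      have h4 := supDist_triangle y₀ z w
      have h5 : 10 * P.L ^ k ≤ supDist z w := by omega
      have h6 : ((10 * P.L ^ k : ℕ) : ℝ) ≤ ((supDist z w : ℕ) : ℝ) := by exact_mod_cast h5
      rw [hT]; push_cast at h6; linarith [h6, hndef]
    have hsup1 : ∀ y, f y ≠ 0 → max (A₀ - s) 0 ≤ B5Ineq137Torus.T P 0 z y := by
      intro y hy
      rw [hT]; refine max_le ?_ (Nat.cast_nonneg _)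
      have h3 := hA₀ y hy
      have h4 : supDist y₀ y ≤ supDist y₀ z + supDist z y := supDist_triangle y₀ z y
      have h5 : ((supDist y₀ y : ℕ) : ℝ) ≤ ((supDist y₀ z + supDist z y : ℕ) : ℝ) := by exact_mod_cast h4
      have h6 : ((supDist y₀ z : ℕ) : ℝ) ≤ s := by exact_mod_cast hz
      push_cast at h5; linarith
    have hsup2 : ∀ w, w ∉ B → max ((δB y₀ : ℝ) - s) 0 ≤ B5Ineq137Torus.T P 0 z w := by
      intro w hw
      rw [hT]; refine max_le ?_ (Nat.cast_nonneg _)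
      have h3 := h1 y₀ w hw
      have h4 : supDist y₀ w ≤ supDist y₀ z + supDist z w := supDist_triangle y₀ z w
      have h5 : ((δB y₀ : ℕ) : ℝ) ≤ ((supDist y₀ z + supDist z w : ℕ) : ℝ) := by exact_mod_cast h3.trans h4
      have h6 : ((supDist y₀ z : ℕ) : ℝ) ≤ s := by exact_mod_cast hz
      push_cast at h5; linarith
    have hm := hvalP z hzB hz10 f F (max (A₀ - s) 0) (max ((δB y₀ : ℝ) - s) 0) Df hF hfB (le_max_right _ _) hsup1 (le_max_right _ _)
      hsup2 hDf hsDf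
    refine hm.trans ?_
    have e1 : Real.exp (-(δ₁ * (n⁻¹ * max (A₀ - s) 0))) ≤ Real.exp (-(t * (A₀ - s) / n)) :=
      (hexp_δ₁ (le_max_right _ _)).trans (hexpD (le_max_left _ _))
    have e2 : Real.exp (-(δ₁ * (n⁻¹ * (max ((δB y₀ : ℝ) - s) 0 + Df)))) ≤
        Real.exp (-(t * ((δB y₀ : ℝ) - s) / n)) * X := by
      rw [show δ₁ * (n⁻¹ * (max ((δB y₀ : ℝ) - s) 0 + Df)) =
          δ₁ * (n⁻¹ * max ((δB y₀ : ℝ) - s) 0) + δ₁ * (n⁻¹ * Df) by ring, neg_add, Real.exp_add, hXdef]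
      exact mul_le_mul ((hexp_δ₁ (le_max_right _ _)).trans (hexpD (le_max_left _ _))) (hexp_δ₁ hDf) (Real.exp_pos _).le
        (Real.exp_pos _).le
    have e3 := mul_le_mul e1 e2 (by positivity) (by positivity)
    calc P.spacing k ^ 2 * (c₁ * Real.exp (-(δ₁ * (n⁻¹ * max (A₀ - ↑s) 0))) *
          Real.exp (-(δ₁ * (n⁻¹ * (max ((δB y₀ : ℝ) - s) 0 + Df)))) * F)
        = (P.spacing k ^ 2 * c₁ * F) * (Real.exp (-(δ₁ * (n⁻¹ * max (A₀ - ↑s) 0))) *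
          Real.exp (-(δ₁ * (n⁻¹ * (max ((δB y₀ : ℝ) - s) 0 + Df))))) := by ring
      _ ≤ (P.spacing k ^ 2 * c₁ * F) * (Real.exp (-(t * (A₀ - s) / n)) * (Real.exp (-(t * ((δB y₀ : ℝ) - s) / n)) * X)) :=
          mul_le_mul_of_nonneg_left e3 (by positivity)
      _ = _ := by ring
  ----------------------------------------------------------------------------------------------------------------
  -- the radius of the interior estimate
  set r : ℕ := ⌊c * n⌋₊ with hrdef
  have hrc : (r : ℝ) ≤ c * n := Nat.floor_le (by positivity)
  by_cases hr4 : r < 4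
  · ----------------------------------------------------------------------------------------------------------------
    -- SMALL CASE `cL^k < 4`: the trivial bound by two values of `v`
    have hn4 : n < 4 / c := by
      have h3 : c * n < r + 1 := Nat.lt_floor_add_one _
      have h4 : (r : ℝ) + 1 ≤ 4 := by exact_mod_cast hr4
      rw [lt_div_iff₀ hc0]; linarith
    have hsD' : ∀ y, f y ≠ 0 → D ≤ (supDist x y : ℝ) := fun y hy => by rw [← hT]; exact hsD y hy
    have hDbx : Db ≤ (δB x : ℝ) := by have := hsDb w₀ hw₀; rwa [hT, ← hδx] at this
    have hvx := hvalue x x 0 hδx14 (le_of_eq ((supDist_eq_zero_iff x x).2 rfl)) (Nat.zero_le _) D hsD'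
    have hvx' := hvalue x (x.shift μ) 1 hδx14 (supDist_shift_le_one' x μ) (by omega) D hsD'
    have hEx : Real.exp (-(t * (D - (0 : ℕ)) / n)) * Real.exp (-(t * ((δB x : ℝ) - (0 : ℕ)) / n)) ≤
        Real.exp (-(t * D / n)) * Real.exp (-(t * Db / n)) := by
      rw [Nat.cast_zero, sub_zero, sub_zero]
      exact mul_le_mul_of_nonneg_left (hexpD hDbx) (Real.exp_pos _).le
    have hEx' : Real.exp (-(t * (D - (1 : ℕ)) / n)) * Real.exp (-(t * ((δB x : ℝ) - (1 : ℕ)) / n)) ≤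
        e ^ 2 * (Real.exp (-(t * D / n)) * Real.exp (-(t * Db / n))) := by
      rw [Nat.cast_one]
      have htn : t / n ≤ 1 := by rw [div_le_one hn]; exact ht1.trans hn1
      have q1 : Real.exp (-(t * (D - 1) / n)) ≤ e * Real.exp (-(t * D / n)) := by
        rw [hedef, ← Real.exp_add]; refine Real.exp_le_exp.2 ?_
        rw [show -(t * (D - 1) / n) = -(t * D / n) + t / n by ring]; linarith
      have q2 : Real.exp (-(t * ((δB x : ℝ) - 1) / n)) ≤ e * Real.exp (-(t * Db / n)) := by
        refine (hexpD (show Db - 1 ≤ (δB x : ℝ) - 1 by linarith)).trans ?_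
        rw [hedef, ← Real.exp_add]; refine Real.exp_le_exp.2 ?_
        rw [show -(t * (Db - 1) / n) = -(t * Db / n) + t / n by ring]; linarith
      calc _ ≤ (e * Real.exp (-(t * D / n))) * (e * Real.exp (-(t * Db / n))) :=
            mul_le_mul q1 q2 (Real.exp_pos _).le (by positivity)
        _ = _ := by ring
    set EXP : ℝ := Real.exp (-(t * D / n)) * Real.exp (-(t * Db / n)) with hEXP
    have hEXP0 : 0 ≤ EXP := by positivity
    have hδ : ‖cfg U ⟨x, μ⟩ * v (x.shift μ) - v x‖ ≤ 2 * e ^ 2 * c₁ * P.spacing k ^ 2 * F * EXP * X := by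
      refine (norm_sub_le _ _).trans ?_
      rw [norm_mul, show ‖cfg U ⟨x, μ⟩‖ = 1 from norm_toC _, one_mul]
      have b1 : ‖v x‖ ≤ c₁ * P.spacing k ^ 2 * F * EXP * X :=
        hvx.trans (mul_le_mul_of_nonneg_right (mul_le_mul_of_nonneg_left hEx (by positivity)) hX0.le)
      have b2 : ‖v (x.shift μ)‖ ≤ c₁ * P.spacing k ^ 2 * F * (e ^ 2 * EXP) * X :=
        hvx'.trans (mul_le_mul_of_nonneg_right (mul_le_mul_of_nonneg_left hEx' (by positivity)) hX0.le)
      have b3 : c₁ * P.spacing k ^ 2 * F * EXP * X ≤ c₁ * P.spacing k ^ 2 * F * (e ^ 2 * EXP) * X := by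
        have : EXP ≤ e ^ 2 * EXP := le_mul_of_one_le_left hEXP0 (one_le_pow₀ he1)
        gcongr
      linarith
    calc P.eps⁻¹ * ‖cfg U ⟨x, μ⟩ * v (x.shift μ) - v x‖ ≤ P.eps⁻¹ * (2 * e ^ 2 * c₁ * P.spacing k ^ 2 * F * EXP * X) :=
          mul_le_mul_of_nonneg_left hδ (inv_nonneg.2 hε.le)
      _ = (2 * e ^ 2 * c₁ * n) * P.spacing k * F * EXP * X := by rw [hsp]; field_simp
      _ ≤ (8 * e ^ 2 * c₁ / c) * P.spacing k * F * EXP * X := by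
          have : 2 * e ^ 2 * c₁ * n ≤ 8 * e ^ 2 * c₁ / c := by
            rw [show 8 * e ^ 2 * c₁ / c = 2 * e ^ 2 * c₁ * (4 / c) by ring]
            exact mul_le_mul_of_nonneg_left hn4.le (by positivity)
          gcongr
      _ ≤ c₂ * P.spacing k * F * EXP * X :=
          mul_le_mul_of_nonneg_right (mul_le_mul_of_nonneg_right (mul_le_mul_of_nonneg_right
            (mul_le_mul_of_nonneg_right hc₂b hsp0.le) hF0) hEXP0) hX0.le
      _ = P.spacing k * (c₂ * Real.exp (-(t * D / n)) * (Real.exp (-(t * Db / n)) * X) * F) := by rw [hEXP]; ring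
  ----------------------------------------------------------------------------------------------------------------
  -- MAIN CASE `r = ⌊cL^k⌋ ≥ 4`
  push Not at hr4
  have hr1 : 1 ≤ r := by omega
  have hr0 : (0 : ℝ) < r := by exact_mod_cast (show 0 < r by omega)
  have hcn4 : 4 ≤ c * n := le_trans (by exact_mod_cast hr4) hrc
  have hr2 : c * n / 2 ≤ r := by have h3 : c * n < r + 1 := Nat.lt_floor_add_one _; linarith
  have hrn : (r : ℝ) ≤ n / 8 := hrc.trans (by nlinarith)
  have hrn' : 8 * r ≤ P.L ^ k := by
    have h3 : 8 * (r : ℝ) ≤ (P.L ^ k : ℕ) := by rw [hncast]; linarith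
    exact_mod_cast h3
  have hN : 4 * r + 6 ≤ P.sitesPerDir 0 := by omega
  -- the trivial sub-case `f = 0`
  by_cases hf0 : ∀ z, f z = 0
  · have hv0 : ∀ y, v y = 0 := fun y => by
      show (gBox _ _ U k B *ᵥ f) y - (gBox _ _ U k Ω *ᵥ f) y = 0
      rw [show f = 0 from funext hf0, mulVec_zero, mulVec_zero, Pi.zero_apply, sub_self]
    rw [hv0, hv0, mul_zero, sub_zero, norm_zero, mul_zero]; positivity
  push Not at hf0
  -- the distance to the support
  set supp : Finset (Balaban1983to89.Site P 0) := univ.filter fun w => f w ≠ 0 with hsuppdef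
  have hne : supp.Nonempty := by obtain ⟨w, hw⟩ := hf0; exact ⟨w, by rw [hsuppdef, mem_filter]; exact ⟨mem_univ _, hw⟩⟩
  have hmem : ∀ {w}, f w ≠ 0 → w ∈ supp := fun hw => by rw [hsuppdef, mem_filter]; exact ⟨mem_univ _, hw⟩
  set Dst : Balaban1983to89.Site P 0 → ℕ := fun z => supp.inf' hne fun w => supDist z w with hDst
  have hDst_le : ∀ z w, f w ≠ 0 → Dst z ≤ supDist z w := fun z w hw => Finset.inf'_le _ (hmem hw)
  have hDst_ex : ∀ z, ∃ w, f w ≠ 0 ∧ Dst z = supDist z w := fun z => by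
    obtain ⟨w, hw, h⟩ := Finset.exists_mem_eq_inf' hne (fun w => supDist z w)
    rw [hsuppdef, mem_filter] at hw
    exact ⟨w, hw.2, h⟩
  have hDst_tri : ∀ y z, Dst y ≤ supDist y z + Dst z := fun y z => by
    obtain ⟨w, hw, h⟩ := hDst_ex z
    rw [h]
    exact (hDst_le y w hw).trans (supDist_triangle y z w)
  -- the weighted maximum over the deep bonds
  set Z : Finset (PBond P 0) := univ.filter fun b => 14 * P.L ^ k ≤ δB b.src with hZdef
  have hmemZ : ∀ b : PBond P 0, b ∈ Z ↔ 14 * P.L ^ k ≤ δB b.src := fun b => by rw [hZdef, mem_filter]; simp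
  have hxZ : (⟨x, μ⟩ : PBond P 0) ∈ Z := (hmemZ _).2 hδx14
  set g : PBond P 0 → ℝ := fun b => Real.exp (t * ((Dst b.src : ℝ) + δB b.src) / n) * ‖cfg U b * v b.tgt - v b.src‖ with hgdef
  obtain ⟨b₀, hb₀Z, hb₀⟩ := exists_max_image Z g ⟨⟨x, μ⟩, hxZ⟩
  set M : ℝ := g b₀ with hMdef
  have hMb : ∀ b ∈ Z, g b ≤ M := fun b hb => hb₀ b hb
  have hM0 : 0 ≤ M := le_trans (by positivity) (hMb ⟨x, μ⟩ hxZ)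
  have hMuse : ∀ (z : Balaban1983to89.Site P 0) (ν : Fin P.d), 14 * P.L ^ k ≤ δB z →
      ‖cfg U ⟨z, ν⟩ * v (z.shift ν) - v z‖ ≤ M * Real.exp (-(t * ((Dst z : ℝ) + δB z) / n)) := by
    intro z ν hz
    have q1 := hMb ⟨z, ν⟩ ((hmemZ _).2 hz)
    simp only [hgdef] at q1
    have q2 : Real.exp (t * ((Dst z : ℝ) + δB z) / n) * Real.exp (-(t * ((Dst z : ℝ) + δB z) / n)) = 1 := by
      rw [← Real.exp_add, add_neg_cancel, Real.exp_zero]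
    calc ‖cfg U ⟨z, ν⟩ * v (z.shift ν) - v z‖
        = (Real.exp (t * ((Dst z : ℝ) + δB z) / n) * ‖cfg U ⟨z, ν⟩ * v (z.shift ν) - v z‖) *
            Real.exp (-(t * ((Dst z : ℝ) + δB z) / n)) := by rw [mul_comm (Real.exp _), mul_assoc, q2, mul_one]
      _ ≤ M * Real.exp (-(t * ((Dst z : ℝ) + δB z) / n)) := mul_le_mul_of_nonneg_right q1 (Real.exp_pos _).le
  ----------------------------------------------------------------------------------------------------------------
  -- THE ABSORPTION STEP at the maximal bond `b₀ = ⟨y₀, μ₀⟩`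
  obtain ⟨y₀, μ₀⟩ := b₀
  have hy₀ : 14 * P.L ^ k ≤ δB y₀ := (hmemZ _).1 hb₀Z
  set E : ℝ := Real.exp (-(t * ((Dst y₀ : ℝ) + δB y₀) / n)) with hEdef
  have hE0 : 0 < E := Real.exp_pos _
  have hEinv : Real.exp (t * ((Dst y₀ : ℝ) + δB y₀) / n) * E = 1 := by rw [hEdef, ← Real.exp_add, add_neg_cancel, Real.exp_zero]
  -- the gauge
  set hg := centredGaugeDir U y₀ (2 * r) μ₀ with hhg
  set U' := GaugeField.gaugeAct hg U with hU'
  set ψ : Balaban1983to89.Site P 0 → ℂ := fun z => toC (hg z) * v z with hψdef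
  set f' : Balaban1983to89.Site P 0 → ℂ := nOp a' P.eps⁻¹ U' k univ *ᵥ ψ with hf'def
  have hψeq : nOp a' P.eps⁻¹ U' k univ *ᵥ ψ = f' := rfl
  have hnormψ : ∀ z, ‖ψ z‖ = ‖v z‖ := fun z => by simp only [hψdef]; rw [norm_mul, norm_toC, one_mul]
  have hcov : ∀ z ν, ‖cfg U' ⟨z, ν⟩ * ψ (z.shift ν) - ψ z‖ = ‖cfg U ⟨z, ν⟩ * v (z.shift ν) - v z‖ := fun z ν =>
    norm_covDiff_gaugeAct hg U v z ν
  set γ : ℝ := ((P.d - 1 : ℕ) : ℝ) * θ with hγdef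
  have hγ0 : 0 ≤ γ := by positivity
  have hγn : γ * n ^ 2 ≤ 1 := gamma_nsq_le_one hθ0 hd1 hsmall
  -- the plaquettes read by the gauge are based within `2r + 2 ≤ 2L^k` of `y₀ ∈ □ ⊆ Ω`: the LOCAL hypothesis suffices
  have hnear : ∀ p : Balaban1983to89.Plaq P 0, supDist y₀ p.src ≤ 2 * r + 2 → dist1 (plaqHol U p) ≤ θ := by
    intro p hp
    rw [dist1_eq_norm_toC_sub_one]
    exact hplaq p ⟨y₀, hsub (mem_of_depth_pos h1 (by omega)), by omega⟩
  have hgauge : ∀ z ν, supDist y₀ z ≤ 2 * r → ‖cfg U' ⟨z, ν⟩ - 1‖ ≤ γ * supDist y₀ z := by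
    intro z ν hz
    have hR : 2 * (2 * r) + 4 < P.sitesPerDir 0 := by omega
    have q1 := dist1_centredGaugeDir_le_supDist_of_near U hθ0 y₀ hnear hR μ₀ z hz ν
    rw [dist1_eq_norm_toC_sub_one] at q1
    calc ‖cfg U' ⟨z, ν⟩ - 1‖ = ‖toC (GaugeField.gaugeAct hg U ⟨z, ν⟩) - 1‖ := rfl
      _ ≤ ((P.d - 1 : ℕ) : ℝ) * (supDist y₀ z : ℝ) * θ := q1
      _ = γ * supDist y₀ z := by rw [hγdef]; ring
  -- the local data: (S) the values on the ball `2r + L^k + 1 ≤ 4L^k`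
  set S₀ : ℝ := c₁ * P.spacing k ^ 2 * F * Real.exp 6 * X with hS₀def
  have hS₀0 : 0 ≤ S₀ := by positivity
  set S : ℝ := E * S₀ with hSdef
  have hS0 : 0 ≤ S := by positivity
  have hslack6 : Real.exp (-(t * ((Dst y₀ : ℝ) - (2 * r + P.L ^ k + 1 : ℕ)) / n)) *
      Real.exp (-(t * ((δB y₀ : ℝ) - (2 * r + P.L ^ k + 1 : ℕ)) / n)) ≤ E * Real.exp 6 := by
    set m : ℝ := ((2 * r + P.L ^ k + 1 : ℕ) : ℝ) with hmdef
    have q1 : m ≤ 3 * n := by rw [hmdef]; push_cast; linarith [hrn, hn1, hndef]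
    have q2 : t * m ≤ 3 * n := by have := mul_le_mul ht1 q1 (by rw [hmdef]; positivity) zero_le_one; linarith
    rw [← Real.exp_add, hEdef, ← Real.exp_add]
    refine Real.exp_le_exp.2 ?_
    have q3 : -(t * ((Dst y₀ : ℝ) - m) / n) + -(t * ((δB y₀ : ℝ) - m) / n) = -(t * ((Dst y₀ : ℝ) + δB y₀) / n) + 2 * (t * m) / n := by
      field_simp; ring
    rw [q3]
    have q4 : 2 * (t * m) / n ≤ 6 := by rw [div_le_iff₀ hn]; linarith
    linarith
  have hSψ : ∀ z, supDist y₀ z ≤ 2 * r + P.L ^ k + 1 → ‖ψ z‖ ≤ S := by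
    intro z hz
    rw [hnormψ]
    have q1 := hvalue y₀ z (2 * r + P.L ^ k + 1) hy₀ hz (by omega) (Dst y₀ : ℝ)
      (fun y hy => by exact_mod_cast hDst_le y₀ y hy)
    refine q1.trans ?_
    rw [hSdef, hS₀def]
    calc c₁ * P.spacing k ^ 2 * F * (Real.exp (-(t * ((Dst y₀ : ℝ) - (2 * r + P.L ^ k + 1 : ℕ)) / n)) *
          Real.exp (-(t * ((δB y₀ : ℝ) - (2 * r + P.L ^ k + 1 : ℕ)) / n))) * X
        ≤ c₁ * P.spacing k ^ 2 * F * (E * Real.exp 6) * X :=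
          mul_le_mul_of_nonneg_right (mul_le_mul_of_nonneg_left hslack6 (by positivity)) hX0.le
      _ = _ := by ring
  -- (M) the covariant differences on the ball `2r`: inside the region by `M`, on its collar by the two derivative members
  set Me : ℝ := 2 * (P.eps * (P.spacing k * (c₀ * F))) * Real.exp (28 * t) * X with hMedef
  have hMe0 : 0 ≤ Me := by positivity
  set Mloc : ℝ := (M + Me) * E * e with hMlocdef
  have hMloc0 : 0 ≤ Mloc := by positivity
  have hball_slack : ∀ z, supDist y₀ z ≤ 2 * r → Real.exp (-(t * ((Dst z : ℝ) + δB z) / n)) ≤ E * e := by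
    intro z hz
    have q1 : ((Dst y₀ : ℕ) : ℝ) ≤ ((2 * r : ℕ) : ℝ) + Dst z := by
      have := (hDst_tri y₀ z).trans (Nat.add_le_add_right hz _); exact_mod_cast this
    have q2 : ((δB y₀ : ℕ) : ℝ) ≤ (δB z : ℝ) + ((2 * r : ℕ) : ℝ) := by
      have := (depth_le_add h1 h2 y₀ z).trans (Nat.add_le_add_left hz _); exact_mod_cast this
    have q3 : 2 * ((2 * r : ℕ) : ℝ) ≤ n := by push_cast; linarith
    rw [hEdef, hedef]
    exact exp_ball hn ht.le ht1 (Nat.cast_nonneg _) q1 q2 q3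
  have hMψ : ∀ z ν, supDist y₀ z ≤ 2 * r → ‖cfg U' ⟨z, ν⟩ * ψ (z.shift ν) - ψ z‖ ≤ Mloc := by
    intro z ν hz
    rw [hcov, hMlocdef]
    have hslk := hball_slack z hz
    by_cases hzZ : 14 * P.L ^ k ≤ δB z
    · calc ‖cfg U ⟨z, ν⟩ * v (z.shift ν) - v z‖ ≤ M * Real.exp (-(t * ((Dst z : ℝ) + δB z) / n)) := hMuse z ν hzZ
        _ ≤ M * (E * e) := mul_le_mul_of_nonneg_left hslk hM0
        _ ≤ (M + Me) * (E * e) := by gcongr; linarith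
        _ = _ := by ring
    · -- the collar of the region: both derivative members apply at `z` (its open `L^k`-ball lies in `□`)
      push Not at hzZ
      have hzball : ∀ y, B5Ineq137Torus.T P 0 z y < n → y ∈ B := by
        intro y hy
        by_contra hyB
        have q1 := h1 z y hyB
        have q2 := depth_le_add h1 h2 y₀ z
        have q3 : P.L ^ k ≤ supDist z y := by omega
        rw [hT, ← hncast] at hy
        exact absurd (by exact_mod_cast hy : supDist z y < P.L ^ k) (not_lt.2 q3)
      have hsz : ∀ y, f y ≠ 0 → (Dst z : ℝ) ≤ B5Ineq137Torus.T P 0 z y := fun y hy => by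
        rw [hT]; exact_mod_cast hDst_le z y hy
      have dB := hDB z hzball f F (Dst z) hF (Nat.cast_nonneg _) hsz ν
      have dΩ := hDΩ z hzball f F (Dst z) hF (Nat.cast_nonneg _) hsz ν
      rw [norm_covD_apply] at dB dΩ
      have dB' : ‖cfg U ⟨z, ν⟩ * (gBox a' P.eps⁻¹ U k B *ᵥ f) (z.shift ν) - (gBox a' P.eps⁻¹ U k B *ᵥ f) z‖ ≤
          P.eps * (P.spacing k * (c₀ * Real.exp (-(δ₀ * (n⁻¹ * Dst z))) * F)) := (inv_mul_le_iff₀ hε).1 dB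
      have dΩ' : ‖cfg U ⟨z, ν⟩ * (gBox a' P.eps⁻¹ U k Ω *ᵥ f) (z.shift ν) - (gBox a' P.eps⁻¹ U k Ω *ᵥ f) z‖ ≤
          P.eps * (P.spacing k * (c₀ * Real.exp (-(δ₀ * (n⁻¹ * Dst z))) * F)) := (inv_mul_le_iff₀ hε).1 dΩ
      have hsplit : cfg U ⟨z, ν⟩ * v (z.shift ν) - v z =
          (cfg U ⟨z, ν⟩ * (gBox a' P.eps⁻¹ U k B *ᵥ f) (z.shift ν) - (gBox a' P.eps⁻¹ U k B *ᵥ f) z) -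
          (cfg U ⟨z, ν⟩ * (gBox a' P.eps⁻¹ U k Ω *ᵥ f) (z.shift ν) - (gBox a' P.eps⁻¹ U k Ω *ᵥ f) z) := by
        simp only [hv]; ring
      -- the exponent on the collar
      obtain ⟨w, hw, hzw⟩ := hDst_ex z
      have hedge : Real.exp (-(δ₀ * (n⁻¹ * Dst z))) ≤
          Real.exp (28 * t) * Real.exp (-(t * ((Dst z : ℝ) + δB z) / n)) * X := by
        rw [show δ₀ * (n⁻¹ * (Dst z : ℝ)) = δ₀ * (Dst z : ℝ) / n by ring, hXdef]
        refine exp_edge hn ht.le htδ₀ (Nat.cast_nonneg _) ?_ ?_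
        · have := hDf_edge z w hw; rw [← hzw] at this; exact this
        · have : ((δB z : ℕ) : ℝ) ≤ ((14 * P.L ^ k : ℕ) : ℝ) := by exact_mod_cast hzZ.le
          push_cast at this; linarith [this, hndef]
      calc ‖cfg U ⟨z, ν⟩ * v (z.shift ν) - v z‖
          ≤ P.eps * (P.spacing k * (c₀ * Real.exp (-(δ₀ * (n⁻¹ * Dst z))) * F)) +
            P.eps * (P.spacing k * (c₀ * Real.exp (-(δ₀ * (n⁻¹ * Dst z))) * F)) := by
            rw [hsplit]; exact (norm_sub_le _ _).trans (add_le_add dB' dΩ')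
        _ = 2 * (P.eps * (P.spacing k * (c₀ * F))) * Real.exp (-(δ₀ * (n⁻¹ * Dst z))) := by ring
        _ ≤ 2 * (P.eps * (P.spacing k * (c₀ * F))) * (Real.exp (28 * t) * Real.exp (-(t * ((Dst z : ℝ) + δB z) / n)) * X) :=
            mul_le_mul_of_nonneg_left hedge (by positivity)
        _ = Me * Real.exp (-(t * ((Dst z : ℝ) + δB z) / n)) := by rw [hMedef]; ring
        _ ≤ Me * (E * e) := mul_le_mul_of_nonneg_left hslk hMe0
        _ ≤ (M + Me) * (E * e) := by gcongr; linarith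
        _ = _ := by ring
  -- (F) the source vanishes on the ball `2r` (harmonicity, transported by the gauge)
  have hFf' : ∀ z, supDist y₀ z ≤ 2 * r → ‖f' z‖ ≤ 0 := by
    intro z hz
    have q1 : f' = fun z => toC (hg z) * (nOp a' P.eps⁻¹ U k univ *ᵥ v) z := by
      rw [hf'def, hψdef]; exact nOp_gaugeAct_mulVec_smul hk0 a' P.eps⁻¹ hg U v
    have q2 : (nOp a' P.eps⁻¹ U k univ *ᵥ v) z = 0 := hharm z (by have := depth_le_add h1 h2 y₀ z; omega)
    rw [q1]; simp only [q2, mul_zero, norm_zero, le_refl]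
  -- THE LOCAL ESTIMATE
  have hmain := hloc P rfl ha hk1 hkK hr4 hN y₀ μ₀ U' ψ f' hψeq hγ0 hS0 hMloc0 le_rfl (fun z => hkerP.1 μ₀ y₀ z)
    (fun ν z => hkerP.2 μ₀ ν y₀ z) hgauge hSψ hMψ hFf'
  -- its left-hand side is `M·E`
  have hLHS : ‖ψ (y₀.shift μ₀) - ψ y₀‖ = M * E := by
    have hu1 : cfg U' ⟨y₀, μ₀⟩ = 1 := by
      have q1 := hgauge y₀ μ₀ (by rw [(supDist_eq_zero_iff y₀ y₀).2 rfl]; exact Nat.zero_le _)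
      rw [(supDist_eq_zero_iff y₀ y₀).2 rfl, Nat.cast_zero, mul_zero] at q1
      exact sub_eq_zero.1 (norm_le_zero_iff.1 q1)
    have q2 : ‖ψ (y₀.shift μ₀) - ψ y₀‖ = ‖cfg U ⟨y₀, μ₀⟩ * v (y₀.shift μ₀) - v y₀‖ := by rw [← hcov, hu1, one_mul]
    rw [q2, hMdef, hgdef]
    show _ = Real.exp (t * ((Dst y₀ : ℝ) + δB y₀) / n) * ‖cfg U ⟨y₀, μ₀⟩ * v (y₀.shift μ₀) - v y₀‖ * E
    rw [mul_comm (Real.exp _), mul_assoc, hEinv, mul_one]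
  rw [hLHS] at hmain
  -- `γ r² ≤ c²`, the contraction factor `κ = C_L e γ r² ≤ 1/2`
  have hγr : γ * (r : ℝ) ^ 2 ≤ c ^ 2 := by
    calc γ * (r : ℝ) ^ 2 ≤ γ * (c * n) ^ 2 := mul_le_mul_of_nonneg_left (pow_le_pow_left₀ hr0.le hrc 2) hγ0
      _ = c ^ 2 * (γ * n ^ 2) := by ring
      _ ≤ c ^ 2 * 1 := mul_le_mul_of_nonneg_left hγn (sq_nonneg c)
      _ = c ^ 2 := mul_one _
  have hκ : C_L * (γ * (r : ℝ) ^ 2) * e ≤ 1 / 2 := by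
    calc C_L * (γ * (r : ℝ) ^ 2) * e ≤ C_L * c ^ 2 * e := by gcongr
      _ = (C_L * e * c) * c := by ring
      _ ≤ (1 / 2) * 1 := mul_le_mul hcC hc1 hc0.le (by norm_num)
      _ = 1 / 2 := by norm_num
  -- divide by `E` and absorb
  set A₁ : ℝ := C_L * ((γ * r + 1 / r + B1RG242Torus.α P a k * P.eps ^ 2 * (r + n)) * S₀) with hA₁def
  have hA₁0 : 0 ≤ A₁ := by positivity
  have hM_le : M ≤ Me + 2 * A₁ := by
    have q1 : M * E ≤ E * (A₁ + (C_L * (γ * (r : ℝ) ^ 2) * e) * (M + Me)) :=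
      calc M * E ≤ C_L * (0 * P.eps ^ 2 * r + γ * r ^ 2 * Mloc + γ * r * S + S / r +
            B1RG242Torus.α P a k * P.eps ^ 2 * (r + n) * S) := hmain
        _ = E * (A₁ + (C_L * (γ * (r : ℝ) ^ 2) * e) * (M + Me)) := by
            simp only [hA₁def, hMlocdef, hSdef]
            ring
    have q2 : M ≤ A₁ + (C_L * (γ * (r : ℝ) ^ 2) * e) * (M + Me) := le_of_mul_le_mul_right (by linarith [q1]) hE0
    have q3 : (C_L * (γ * (r : ℝ) ^ 2) * e) * (M + Me) ≤ (1 / 2) * (M + Me) := mul_le_mul_of_nonneg_right hκ (by positivity)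
    linarith
  -- `A₁ ≤ C_L K₁ · n ε² F X`
  set Y : ℝ := n * P.eps ^ 2 * F * X with hYdef
  have hY0 : 0 ≤ Y := by positivity
  have hS₀Y : S₀ = c₁ * Real.exp 6 * n * Y := by rw [hS₀def, hYdef, hsp]; ring
  have hA₁le : A₁ ≤ C_L * K₁ * Y := by
    have q2 : γ * r * n ≤ c := by
      calc γ * r * n ≤ γ * (c * n) * n := mul_le_mul_of_nonneg_right (mul_le_mul_of_nonneg_left hrc hγ0) hn.le
        _ = c * (γ * n ^ 2) := by ring
        _ ≤ c * 1 := mul_le_mul_of_nonneg_left hγn hc0.le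
        _ = c := mul_one _
    have q3 : 1 / (r : ℝ) * n ≤ 2 / c := by
      rw [one_div_mul_eq_div, div_le_div_iff₀ hr0 hc0]
      linarith [hr2]
    have q4 : B1RG242Torus.α P a k * P.eps ^ 2 * (r + n) * n ≤ 2 * a := by
      have q5 : (r : ℝ) + n ≤ 2 * n := by linarith [hrn, hn.le]
      have q6 : B1RG242Torus.α P a k * P.eps ^ 2 * n * n = B1RG242Torus.α P a k * P.spacing k ^ 2 := by rw [hsp]; ring
      calc B1RG242Torus.α P a k * P.eps ^ 2 * (r + n) * n ≤ B1RG242Torus.α P a k * P.eps ^ 2 * (2 * n) * n :=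
            mul_le_mul_of_nonneg_right (mul_le_mul_of_nonneg_left q5 (by positivity)) hn.le
        _ = 2 * (B1RG242Torus.α P a k * P.spacing k ^ 2) := by rw [← q6]; ring
        _ ≤ 2 * a := by linarith [hαa]
    have hsum : (γ * r + 1 / r + B1RG242Torus.α P a k * P.eps ^ 2 * (r + n)) * n ≤ c + 2 / c + 2 * a := by
      have : (γ * r + 1 / r + B1RG242Torus.α P a k * P.eps ^ 2 * (r + n)) * n =
          γ * r * n + 1 / (r : ℝ) * n + B1RG242Torus.α P a k * P.eps ^ 2 * (r + n) * n := by ring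
      rw [this]; linarith
    rw [hA₁def, hS₀Y, hK₁]
    calc C_L * ((γ * r + 1 / r + B1RG242Torus.α P a k * P.eps ^ 2 * (r + n)) * (c₁ * Real.exp 6 * n * Y))
        = C_L * (c₁ * Real.exp 6) * Y * ((γ * r + 1 / r + B1RG242Torus.α P a k * P.eps ^ 2 * (r + n)) * n) := by ring
      _ ≤ C_L * (c₁ * Real.exp 6) * Y * (c + 2 / c + 2 * a) := mul_le_mul_of_nonneg_left hsum (by positivity)
      _ = C_L * (c₁ * Real.exp 6 * (c + 2 / c + 2 * a)) * Y := by ring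
  have hMe_le : Me ≤ 2 * Real.exp 29 * c₀ * Y := by
    have q1 : Real.exp (28 * t) ≤ Real.exp 29 := Real.exp_le_exp.2 (by linarith)
    calc Me = 2 * c₀ * Real.exp (28 * t) * Y := by rw [hMedef, hYdef, hsp]; ring
      _ ≤ 2 * c₀ * Real.exp 29 * Y := mul_le_mul_of_nonneg_right (mul_le_mul_of_nonneg_left q1 (by positivity)) hY0
      _ = _ := by ring
  -- conclusion at the bond `⟨x, μ⟩`
  have hDx : D ≤ (Dst x : ℝ) := by
    obtain ⟨w, hw, h⟩ := hDst_ex x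
    rw [h, ← hT]; exact hsD w hw
  have hDbx : Db ≤ (δB x : ℝ) := by have := hsDb w₀ hw₀; rwa [hT, ← hδx] at this
  have hMtot : M ≤ (2 * C_L * K₁ + 2 * Real.exp 29 * c₀) * Y := by linarith [hM_le, hA₁le, hMe_le]
  have hδxbound : ‖cfg U ⟨x, μ⟩ * v (x.shift μ) - v x‖ ≤
      (2 * C_L * K₁ + 2 * Real.exp 29 * c₀) * Y * (Real.exp (-(t * D / n)) * Real.exp (-(t * Db / n))) := by
    refine (hMuse x μ hδx14).trans ?_
    have q2 : Real.exp (-(t * ((Dst x : ℝ) + δB x) / n)) ≤ Real.exp (-(t * D / n)) * Real.exp (-(t * Db / n)) := by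
      rw [← Real.exp_add]
      refine Real.exp_le_exp.2 ?_
      rw [show -(t * D / n) + -(t * Db / n) = -(t * (D + Db) / n) by ring, neg_le_neg_iff]
      exact div_le_div_of_nonneg_right (mul_le_mul_of_nonneg_left (add_le_add hDx hDbx) ht.le) hn.le
    exact mul_le_mul hMtot q2 (Real.exp_pos _).le (by positivity)
  calc P.eps⁻¹ * ‖cfg U ⟨x, μ⟩ * v (x.shift μ) - v x‖
      ≤ P.eps⁻¹ * ((2 * C_L * K₁ + 2 * Real.exp 29 * c₀) * Y * (Real.exp (-(t * D / n)) * Real.exp (-(t * Db / n)))) :=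
        mul_le_mul_of_nonneg_left hδxbound (inv_nonneg.2 hε.le)
    _ = (2 * C_L * K₁ + 2 * Real.exp 29 * c₀) * P.spacing k * F * (Real.exp (-(t * D / n)) * Real.exp (-(t * Db / n))) * X := by
        rw [hYdef, hsp]; field_simp
    _ ≤ c₂ * P.spacing k * F * (Real.exp (-(t * D / n)) * Real.exp (-(t * Db / n))) * X :=
        mul_le_mul_of_nonneg_right (mul_le_mul_of_nonneg_right (mul_le_mul_of_nonneg_right
          (mul_le_mul_of_nonneg_right hc₂a hsp0.le) hF0) (by positivity)) hX0.le
    _ = P.spacing k * (c₂ * Real.exp (-(t * D / n)) * (Real.exp (-(t * Db / n)) * X) * F) := by ring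

/-! ## §3 The row extensions: covariant derivative at the rows whose open `L^k`-ball lies in `□`, value at every row -/

/-- **THE SAME MEMBER AT EVERY ROW WHOSE OPEN `L^k`-BALL LIES IN `□`** (p30 g29's `close112_smallField_deriv_of_inputs_ballRows` re-run on §2:
the row hypothesis `14L^k ≤ T(x,w)` weakened to `L^k ≤ T(x,w)` for all `w ∉ □` — on the shallow rows the two (H1.10″)-`D` members alone give the
bound at the admissible distance `max(D, D_f − 14L^k)`; constants `(max(c₂, 2c₀e^{14δ₀}), min(δ₂, δ₀/2))`).  Same local hypothesis on `u`.
[cite: Balaban1983RegularityDecay, Theorem p.573 (1.10)–(1.12)] [cite: BalabanImbrieJaffe1985, (7.3.1) p.326] [cite: BalabanImbrieJaffe1988, (2.31)–(2.32) p.263] -/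
theorem close112_smoothNear_deriv_of_inputs_ballRows (d L : ℕ) (hd : 2 ≤ d) (hd3 : d ≤ 3) (hL : Odd L ∧ 1 < L) {a : ℝ} (ha : 0 < a)
    {c₀ δ₀ : ℝ} (hc₀ : 0 ≤ c₀) (hδ₀ : 0 < δ₀) :
    ∃ c₂ δ₂ : ℝ, 0 < c₂ ∧ 0 < δ₂ ∧ ∀ (P : Params), P.d = d → P.L = L → ∀ k : ℕ, 1 ≤ k → k ≤ P.K →
      ∀ (U : GaugeField P 0 U1) (Ω : Finset (Balaban1983to89.Site P 0)) (θ : ℝ), 0 ≤ θ →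
      (∀ p : Balaban1983to89.Plaq P 0, (∃ y ∈ Ω, supDist y p.src ≤ 2 * P.L ^ k) → ‖toC (plaqHol U p) - 1‖ ≤ θ) →
      2 * (P.d : ℝ) ^ 3 * (((P.L : ℝ) ^ k) ^ 2 * θ) ^ 2 ≤ 1 →
      ∀ (T : ℝ), ((P.d - 1 : ℕ) : ℝ) * ((P.L : ℝ) ^ k - 1) * θ ≤ T →
        2 * (((P.L : ℝ) ^ k - 1) * (P.L : ℝ) ^ k) * P.d * T ^ 2 + 2 * (P.d * ((P.L : ℝ) ^ k - 1) * T) ^ 2 ≤ 1 / 2 →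
      ∀ (B : Finset (Balaban1983to89.Site P 0)), IsBlockUnion k B → IsBlockUnion k Ω → B ⊆ Ω →
      (∀ x ∈ B, ∀ (f : Balaban1983to89.Site P 0 → ℂ) (F D : ℝ), (∀ y, ‖f y‖ ≤ F) → 0 ≤ D →
          (∀ y, f y ≠ 0 → D ≤ B5Ineq137Torus.T P 0 x y) →
          ‖(gBox (B1RG242Torus.α P a k * (P.L : ℝ) ^ (k * P.d)) P.eps⁻¹ U k B *ᵥ f) x‖ ≤
            P.spacing k ^ 2 * (c₀ * Real.exp (-(δ₀ * (((P.L : ℝ) ^ k)⁻¹ * D))) * F)) →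
      (∀ x ∈ B, ∀ (f : Balaban1983to89.Site P 0 → ℂ) (F D : ℝ), (∀ y, ‖f y‖ ≤ F) → 0 ≤ D →
          (∀ y, f y ≠ 0 → D ≤ B5Ineq137Torus.T P 0 x y) →
          ‖(gBox (B1RG242Torus.α P a k * (P.L : ℝ) ^ (k * P.d)) P.eps⁻¹ U k Ω *ᵥ f) x‖ ≤
            P.spacing k ^ 2 * (c₀ * Real.exp (-(δ₀ * (((P.L : ℝ) ^ k)⁻¹ * D))) * F)) →
      (∀ x, (∀ y, B5Ineq137Torus.T P 0 x y < (P.L : ℝ) ^ k → y ∈ B) →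
          ∀ (f : Balaban1983to89.Site P 0 → ℂ) (F D : ℝ), (∀ y, ‖f y‖ ≤ F) → 0 ≤ D →
          (∀ y, f y ≠ 0 → D ≤ B5Ineq137Torus.T P 0 x y) → ∀ (μ : Fin P.d),
          ‖covD P.eps⁻¹ (cfg U) (gBox (B1RG242Torus.α P a k * (P.L : ℝ) ^ (k * P.d)) P.eps⁻¹ U k B *ᵥ f) ⟨x, μ⟩‖ ≤
            P.spacing k * (c₀ * Real.exp (-(δ₀ * (((P.L : ℝ) ^ k)⁻¹ * D))) * F)) →
      (∀ x, (∀ y, B5Ineq137Torus.T P 0 x y < (P.L : ℝ) ^ k → y ∈ B) →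
          ∀ (f : Balaban1983to89.Site P 0 → ℂ) (F D : ℝ), (∀ y, ‖f y‖ ≤ F) → 0 ≤ D →
          (∀ y, f y ≠ 0 → D ≤ B5Ineq137Torus.T P 0 x y) → ∀ (μ : Fin P.d),
          ‖covD P.eps⁻¹ (cfg U) (gBox (B1RG242Torus.α P a k * (P.L : ℝ) ^ (k * P.d)) P.eps⁻¹ U k Ω *ᵥ f) ⟨x, μ⟩‖ ≤
            P.spacing k * (c₀ * Real.exp (-(δ₀ * (((P.L : ℝ) ^ k)⁻¹ * D))) * F)) →
      ∀ x ∈ B, (∀ w, w ∉ B → (P.L : ℝ) ^ k ≤ B5Ineq137Torus.T P 0 x w) →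
      ∀ (f : Balaban1983to89.Site P 0 → ℂ) (F D Db Df : ℝ), (∀ y, ‖f y‖ ≤ F) → (∀ y, y ∉ B → f y = 0) →
        0 ≤ D → (∀ y, f y ≠ 0 → D ≤ B5Ineq137Torus.T P 0 x y) → 0 ≤ Db → (∀ w, w ∉ B → Db ≤ B5Ineq137Torus.T P 0 x w) →
        0 ≤ Df → (∀ y, f y ≠ 0 → ∀ w, w ∉ B → Df ≤ B5Ineq137Torus.T P 0 y w) → ∀ (μ : Fin P.d),
        ‖covD P.eps⁻¹ (cfg U) (gBox (B1RG242Torus.α P a k * (P.L : ℝ) ^ (k * P.d)) P.eps⁻¹ U k B *ᵥ f) ⟨x, μ⟩ -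
            covD P.eps⁻¹ (cfg U) (gBox (B1RG242Torus.α P a k * (P.L : ℝ) ^ (k * P.d)) P.eps⁻¹ U k Ω *ᵥ f) ⟨x, μ⟩‖ ≤
          P.spacing k * (c₂ * Real.exp (-(δ₂ * (((P.L : ℝ) ^ k)⁻¹ * D))) *
            Real.exp (-(δ₂ * (((P.L : ℝ) ^ k)⁻¹ * (Db + Df)))) * F) := by
  obtain ⟨c₂, δ₂, hc₂, hδ₂, H⟩ := close112_smoothNear_deriv_of_inputs d L hd hd3 hL ha hc₀ hδ₀
  refine ⟨max c₂ (2 * c₀ * Real.exp (14 * δ₀)), min δ₂ (δ₀ / 2), lt_max_of_lt_left hc₂, lt_min hδ₂ (half_pos hδ₀), ?_⟩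
  intro P hPd hPL k hk1 hkK U Ω θ hθ0 hplaq hsmall Tb hTb hsmallTb B hB hΩ hsub hGB hGΩ hDB hDΩ x hx hrow f F D Db Df hF hfB hD hsD hDb
    hsDb hDf hsDf μ
  have hPk : (0 : ℝ) < (P.L : ℝ) ^ k := pow_pos P.cast_L_pos k
  have hF0 : 0 ≤ F := (norm_nonneg _).trans (hF x)
  have hsk : 0 ≤ P.spacing k := (P.spacing_pos k).le
  have hE1 : 0 ≤ ((P.L : ℝ) ^ k)⁻¹ * D := mul_nonneg (inv_pos.2 hPk).le hD
  have hE2 : 0 ≤ ((P.L : ℝ) ^ k)⁻¹ * (Db + Df) := mul_nonneg (inv_pos.2 hPk).le (add_nonneg hDb hDf)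
  -- the open `L^k`-ball around `x` lies in `□`
  have hball : ∀ y, B5Ineq137Torus.T P 0 x y < (P.L : ℝ) ^ k → y ∈ B := by
    intro y hy
    by_contra hyB
    exact absurd (hrow y hyB) (not_le.2 hy)
  by_cases hdeep : ∀ w, w ∉ B → 14 * (P.L : ℝ) ^ k ≤ B5Ineq137Torus.T P 0 x w
  · -- deep row: gen 28's theorem with the constants weakened
    refine (H P hPd hPL k hk1 hkK U Ω θ hθ0 hplaq hsmall Tb hTb hsmallTb B hB hΩ hsub hGB hGΩ hDB hDΩ x hx hdeep f F D Db Df hF hfB hD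
      hsD hDb hsDb hDf hsDf μ).trans ?_
    exact mul_le_mul_of_nonneg_left (mono_bound2 hc₂.le (le_max_left _ _) (min_le_left _ _) hE1 hE2 hF0) hsk
  · -- shallow row: the two covariant-derivative members at the admissible distance `D″ = max(D, D_f − 14L^k)`
    push Not at hdeep
    obtain ⟨w₀, hw₀, hlt⟩ := hdeep
    have hD'' : 0 ≤ max D (Df - 14 * (P.L : ℝ) ^ k) := hD.trans (le_max_left _ _)
    have hsD'' := adm_dist_of_shallow hw₀ hlt hsD hsDf
    have hB1 := hDB x hball f F _ hF hD'' hsD'' μ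
    have hΩ1 := hDΩ x hball f F _ hF hD'' hsD'' μ
    have hDb' : Db ≤ 14 * (P.L : ℝ) ^ k := (hsDb w₀ hw₀).trans hlt.le
    have hDf' : Df ≤ max D (Df - 14 * (P.L : ℝ) ^ k) + 14 * (P.L : ℝ) ^ k := by
      have := le_max_right D (Df - 14 * (P.L : ℝ) ^ k); linarith
    have hbud := shallow_budget (D := D) (R := 14) hPk hδ₀.le (le_max_left _ _) hDf' hDb'
    calc ‖covD P.eps⁻¹ (cfg U) (gBox (B1RG242Torus.α P a k * (P.L : ℝ) ^ (k * P.d)) P.eps⁻¹ U k B *ᵥ f) ⟨x, μ⟩ -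
            covD P.eps⁻¹ (cfg U) (gBox (B1RG242Torus.α P a k * (P.L : ℝ) ^ (k * P.d)) P.eps⁻¹ U k Ω *ᵥ f) ⟨x, μ⟩‖
        ≤ ‖covD P.eps⁻¹ (cfg U) (gBox (B1RG242Torus.α P a k * (P.L : ℝ) ^ (k * P.d)) P.eps⁻¹ U k B *ᵥ f) ⟨x, μ⟩‖ +
            ‖covD P.eps⁻¹ (cfg U) (gBox (B1RG242Torus.α P a k * (P.L : ℝ) ^ (k * P.d)) P.eps⁻¹ U k Ω *ᵥ f) ⟨x, μ⟩‖ :=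
          norm_sub_le _ _
      _ ≤ P.spacing k * (c₀ * Real.exp (-(δ₀ * (((P.L : ℝ) ^ k)⁻¹ * max D (Df - 14 * (P.L : ℝ) ^ k)))) * F) +
            P.spacing k * (c₀ * Real.exp (-(δ₀ * (((P.L : ℝ) ^ k)⁻¹ * max D (Df - 14 * (P.L : ℝ) ^ k)))) * F) :=
          add_le_add hB1 hΩ1
      _ = P.spacing k * (2 * c₀ * Real.exp (-(δ₀ * (((P.L : ℝ) ^ k)⁻¹ * max D (Df - 14 * (P.L : ℝ) ^ k)))) * F) := by ring
      _ ≤ P.spacing k * (2 * c₀ * Real.exp (14 * δ₀) * Real.exp (-(δ₀ / 2 * (((P.L : ℝ) ^ k)⁻¹ * D))) *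
            Real.exp (-(δ₀ / 2 * (((P.L : ℝ) ^ k)⁻¹ * (Db + Df)))) * F) := by
          refine mul_le_mul_of_nonneg_left ?_ hsk
          have h2c : 0 ≤ 2 * c₀ := by positivity
          calc 2 * c₀ * Real.exp (-(δ₀ * (((P.L : ℝ) ^ k)⁻¹ * max D (Df - 14 * (P.L : ℝ) ^ k)))) * F
              ≤ 2 * c₀ * (Real.exp (14 * δ₀) * Real.exp (-(δ₀ / 2 * (((P.L : ℝ) ^ k)⁻¹ * D))) *
                  Real.exp (-(δ₀ / 2 * (((P.L : ℝ) ^ k)⁻¹ * (Db + Df))))) * F :=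
                mul_le_mul_of_nonneg_right (mul_le_mul_of_nonneg_left hbud h2c) hF0
            _ = _ := by ring
      _ ≤ P.spacing k * (max c₂ (2 * c₀ * Real.exp (14 * δ₀)) * Real.exp (-(min δ₂ (δ₀ / 2) * (((P.L : ℝ) ^ k)⁻¹ * D))) *
            Real.exp (-(min δ₂ (δ₀ / 2) * (((P.L : ℝ) ^ k)⁻¹ * (Db + Df)))) * F) :=
          mul_le_mul_of_nonneg_left (mono_bound2 (by positivity) (le_max_right _ _) (min_le_right _ _) hE1 hE2 hF0) hsk

/-- **C-I's VALUE MEMBER `close112_smoothNear_of_inputs` AT EVERY ROW `x ∈ □`** (p30 g29's `close112_smallField_of_inputs_allRows` re-run: the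
row hypothesis `10L^k ≤ T(x,w)` deleted — on the shallow rows the two (H1.10″) value members alone give the bound at the admissible distance
`max(D, D_f − 10L^k)`; constants `(max(c₁, 2c₀e^{10δ₀}), min(δ₁, δ₀/2))`).  Same local hypothesis on `u` (plaquette-small near `Ω` only).
[cite: Balaban1983RegularityDecay, Theorem p.573 (1.11)–(1.12)] [cite: BalabanImbrieJaffe1985, (7.3.1) p.326] [cite: BalabanImbrieJaffe1988, (2.31)–(2.32) p.263] -/
theorem close112_smoothNear_of_inputs_allRows (d L : ℕ) (hd : 2 ≤ d) (hd3 : d ≤ 3) (hL : Odd L ∧ 1 < L) {a : ℝ} (ha : 0 < a)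
    {c₀ δ₀ : ℝ} (hc₀ : 0 ≤ c₀) (hδ₀ : 0 < δ₀) :
    ∃ c₁ δ₁ : ℝ, 0 < c₁ ∧ 0 < δ₁ ∧ ∀ (P : Params), P.d = d → P.L = L → ∀ k : ℕ, 1 ≤ k → k ≤ P.K →
      ∀ (U : GaugeField P 0 U1) (Ω : Finset (Balaban1983to89.Site P 0)) (θ : ℝ), 0 ≤ θ →
      (∀ p : Balaban1983to89.Plaq P 0, (∃ y ∈ Ω, supDist y p.src ≤ 2 * P.L ^ k) → ‖toC (plaqHol U p) - 1‖ ≤ θ) →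
      2 * (P.d : ℝ) ^ 3 * (((P.L : ℝ) ^ k) ^ 2 * θ) ^ 2 ≤ 1 →
      ∀ (T : ℝ), ((P.d - 1 : ℕ) : ℝ) * ((P.L : ℝ) ^ k - 1) * θ ≤ T →
        2 * (((P.L : ℝ) ^ k - 1) * (P.L : ℝ) ^ k) * P.d * T ^ 2 + 2 * (P.d * ((P.L : ℝ) ^ k - 1) * T) ^ 2 ≤ 1 / 2 →
      ∀ (B : Finset (Balaban1983to89.Site P 0)), IsBlockUnion k B → IsBlockUnion k Ω → B ⊆ Ω →
      (∀ x ∈ B, ∀ (f : Balaban1983to89.Site P 0 → ℂ) (F D : ℝ), (∀ y, ‖f y‖ ≤ F) → 0 ≤ D →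
          (∀ y, f y ≠ 0 → D ≤ B5Ineq137Torus.T P 0 x y) →
          ‖(gBox (B1RG242Torus.α P a k * (P.L : ℝ) ^ (k * P.d)) P.eps⁻¹ U k B *ᵥ f) x‖ ≤
            P.spacing k ^ 2 * (c₀ * Real.exp (-(δ₀ * (((P.L : ℝ) ^ k)⁻¹ * D))) * F)) →
      (∀ x ∈ B, ∀ (f : Balaban1983to89.Site P 0 → ℂ) (F D : ℝ), (∀ y, ‖f y‖ ≤ F) → 0 ≤ D →
          (∀ y, f y ≠ 0 → D ≤ B5Ineq137Torus.T P 0 x y) →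
          ‖(gBox (B1RG242Torus.α P a k * (P.L : ℝ) ^ (k * P.d)) P.eps⁻¹ U k Ω *ᵥ f) x‖ ≤
            P.spacing k ^ 2 * (c₀ * Real.exp (-(δ₀ * (((P.L : ℝ) ^ k)⁻¹ * D))) * F)) →
      ∀ x ∈ B, ∀ (f : Balaban1983to89.Site P 0 → ℂ) (F D Db Df : ℝ), (∀ y, ‖f y‖ ≤ F) → (∀ y, y ∉ B → f y = 0) →
        0 ≤ D → (∀ y, f y ≠ 0 → D ≤ B5Ineq137Torus.T P 0 x y) → 0 ≤ Db → (∀ w, w ∉ B → Db ≤ B5Ineq137Torus.T P 0 x w) →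
        0 ≤ Df → (∀ y, f y ≠ 0 → ∀ w, w ∉ B → Df ≤ B5Ineq137Torus.T P 0 y w) →
        ‖(gBox (B1RG242Torus.α P a k * (P.L : ℝ) ^ (k * P.d)) P.eps⁻¹ U k B *ᵥ f) x -
            (gBox (B1RG242Torus.α P a k * (P.L : ℝ) ^ (k * P.d)) P.eps⁻¹ U k Ω *ᵥ f) x‖ ≤
          P.spacing k ^ 2 * (c₁ * Real.exp (-(δ₁ * (((P.L : ℝ) ^ k)⁻¹ * D))) *
            Real.exp (-(δ₁ * (((P.L : ℝ) ^ k)⁻¹ * (Db + Df)))) * F) := by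
  obtain ⟨c₁, δ₁, hc₁, hδ₁, H⟩ := close112_smoothNear_of_inputs d L hd hd3 hL ha hc₀ hδ₀
  refine ⟨max c₁ (2 * c₀ * Real.exp (10 * δ₀)), min δ₁ (δ₀ / 2), lt_max_of_lt_left hc₁, lt_min hδ₁ (half_pos hδ₀), ?_⟩
  intro P hPd hPL k hk1 hkK U Ω θ hθ0 hplaq hsmall Tb hTb hsmallTb B hB hΩ hsub hGB hGΩ x hx f F D Db Df hF hfB hD hsD hDb hsDb hDf
    hsDf
  have hPk : (0 : ℝ) < (P.L : ℝ) ^ k := pow_pos P.cast_L_pos k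
  have hF0 : 0 ≤ F := (norm_nonneg _).trans (hF x)
  have hsk2 : 0 ≤ P.spacing k ^ 2 := sq_nonneg _
  have hE1 : 0 ≤ ((P.L : ℝ) ^ k)⁻¹ * D := mul_nonneg (inv_pos.2 hPk).le hD
  have hE2 : 0 ≤ ((P.L : ℝ) ^ k)⁻¹ * (Db + Df) := mul_nonneg (inv_pos.2 hPk).le (add_nonneg hDb hDf)
  by_cases hdeep : ∀ w, w ∉ B → 10 * (P.L : ℝ) ^ k ≤ B5Ineq137Torus.T P 0 x w
  · -- deep row: gen 27's theorem with the constants weakened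
    refine (H P hPd hPL k hk1 hkK U Ω θ hθ0 hplaq hsmall Tb hTb hsmallTb B hB hΩ hsub hGB hGΩ x hx hdeep f F D Db Df hF hfB hD hsD hDb
      hsDb hDf hsDf).trans ?_
    exact mul_le_mul_of_nonneg_left (mono_bound2 hc₁.le (le_max_left _ _) (min_le_left _ _) hE1 hE2 hF0) hsk2
  · -- shallow row: the two value members at the admissible distance `D″ = max(D, D_f − 10L^k)`
    push Not at hdeep
    obtain ⟨w₀, hw₀, hlt⟩ := hdeep
    have hD'' : 0 ≤ max D (Df - 10 * (P.L : ℝ) ^ k) := hD.trans (le_max_left _ _)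
    have hsD'' := adm_dist_of_shallow hw₀ hlt hsD hsDf
    have hB1 := hGB x hx f F _ hF hD'' hsD''
    have hΩ1 := hGΩ x hx f F _ hF hD'' hsD''
    have hDb' : Db ≤ 10 * (P.L : ℝ) ^ k := (hsDb w₀ hw₀).trans hlt.le
    have hDf' : Df ≤ max D (Df - 10 * (P.L : ℝ) ^ k) + 10 * (P.L : ℝ) ^ k := by
      have := le_max_right D (Df - 10 * (P.L : ℝ) ^ k); linarith
    have hbud := shallow_budget (D := D) (R := 10) hPk hδ₀.le (le_max_left _ _) hDf' hDb'
    calc ‖(gBox (B1RG242Torus.α P a k * (P.L : ℝ) ^ (k * P.d)) P.eps⁻¹ U k B *ᵥ f) x -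
            (gBox (B1RG242Torus.α P a k * (P.L : ℝ) ^ (k * P.d)) P.eps⁻¹ U k Ω *ᵥ f) x‖
        ≤ ‖(gBox (B1RG242Torus.α P a k * (P.L : ℝ) ^ (k * P.d)) P.eps⁻¹ U k B *ᵥ f) x‖ +
            ‖(gBox (B1RG242Torus.α P a k * (P.L : ℝ) ^ (k * P.d)) P.eps⁻¹ U k Ω *ᵥ f) x‖ := norm_sub_le _ _
      _ ≤ P.spacing k ^ 2 * (c₀ * Real.exp (-(δ₀ * (((P.L : ℝ) ^ k)⁻¹ * max D (Df - 10 * (P.L : ℝ) ^ k)))) * F) +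
            P.spacing k ^ 2 * (c₀ * Real.exp (-(δ₀ * (((P.L : ℝ) ^ k)⁻¹ * max D (Df - 10 * (P.L : ℝ) ^ k)))) * F) :=
          add_le_add hB1 hΩ1
      _ = P.spacing k ^ 2 * (2 * c₀ * Real.exp (-(δ₀ * (((P.L : ℝ) ^ k)⁻¹ * max D (Df - 10 * (P.L : ℝ) ^ k)))) * F) := by ring
      _ ≤ P.spacing k ^ 2 * (2 * c₀ * Real.exp (10 * δ₀) * Real.exp (-(δ₀ / 2 * (((P.L : ℝ) ^ k)⁻¹ * D))) *
            Real.exp (-(δ₀ / 2 * (((P.L : ℝ) ^ k)⁻¹ * (Db + Df)))) * F) := by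
          refine mul_le_mul_of_nonneg_left ?_ hsk2
          have h2c : 0 ≤ 2 * c₀ := by positivity
          calc 2 * c₀ * Real.exp (-(δ₀ * (((P.L : ℝ) ^ k)⁻¹ * max D (Df - 10 * (P.L : ℝ) ^ k)))) * F
              ≤ 2 * c₀ * (Real.exp (10 * δ₀) * Real.exp (-(δ₀ / 2 * (((P.L : ℝ) ^ k)⁻¹ * D))) *
                  Real.exp (-(δ₀ / 2 * (((P.L : ℝ) ^ k)⁻¹ * (Db + Df))))) * F :=
                mul_le_mul_of_nonneg_right (mul_le_mul_of_nonneg_left hbud h2c) hF0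
            _ = _ := by ring
      _ ≤ P.spacing k ^ 2 * (max c₁ (2 * c₀ * Real.exp (10 * δ₀)) * Real.exp (-(min δ₁ (δ₀ / 2) * (((P.L : ℝ) ^ k)⁻¹ * D))) *
            Real.exp (-(min δ₁ (δ₀ / 2) * (((P.L : ℝ) ^ k)⁻¹ * (Db + Df)))) * F) :=
          mul_le_mul_of_nonneg_left (mono_bound2 (by positivity) (le_max_right _ _) (min_le_right _ _) hE1 hE2 hF0) hsk2

end Main

section Package

/-! ## §4 The four (H1.10″) inputs discharged by the LOCAL members; the closeness members hypothesis-free -/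

/-- **THE FOUR (H1.10″) INPUTS OF THE (1.11)–(1.12) CLAUSE FOR NESTED `k`-BLOCK UNIONS `□ ⊆ Ω` AT A `U(1)` FIELD PLAQUETTE-SMALL NEAR `Ω`
ONLY, PACKAGED ONCE** (p30 g29's `inputs110_smallPlaquette_region` with p34 gen 20's LOCAL members: B-I `decay110_smoothNear_region` for the
values of `G_k(□,u)` and `G_k(Ω,u)` — `□ ⊆ Ω` is a `k`-block union, so the plaquettes based within `2L^k` of `□` are based within `2L^k` of
`Ω` —, B-II `decay110_smoothNear_region_deriv_uniform` for their covariant derivatives, at the common constants): for `1 ≤ d`, `d + 1 ≤ 3`,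
`ℓ ≥ 1` with `ℓ + 1` odd, `a > 0` there are `c₀ ≥ 0`, `δ₀ > 0` such that for every volume (`P.d = d + 1`, `P.L = ℓ + 1`), every `1 ≤ k ≤ K`
with `2(L^k − 1) + 4 < |T|`, every region `Ω` and `U(1)` field `u` with `‖u(∂p) − 1‖ ≤ θ` for the plaquettes based within `2L^k` of `Ω`,
`0 ≤ θ`, `((L^k)²θ)² ≤ 1/500`, and all nested `k`-block unions `□ ⊆ Ω`: the thresholds `2d′³((L^k)²θ)² ≤ 1` and
`2(L^k−1)L^k·d′·T₀² + 2(d′(L^k−1)T₀)² ≤ ½` at `T₀ = (d′−1)(L^k−1)θ`, and (hGB) `‖(G_k(□,u)f)(x)‖ ≤ (L^kε)²c₀e^{−δ₀D/L^k}F`, (hGΩ) the same for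
`G_k(Ω,u)`, at every `x ∈ □`; (hDB) `‖covD ε⁻¹ u (G_k(□,u)f)⟨x,μ⟩‖ ≤ (L^kε)c₀e^{−δ₀D/L^k}F`, (hDΩ) the same for `G_k(Ω,u)`, at every `x` with
`{T(x,·) < L^k} ⊆ □` — literally the hypotheses of §2.
[cite: Balaban1983RegularityDecay, Theorem p.573 (1.10)] [cite: BalabanImbrieJaffe1985, (7.3.1) p.326] [cite: BalabanImbrieJaffe1988, (2.32) p.263] -/
theorem inputs110_smoothNear_region (d ℓ : ℕ) (hd1 : 1 ≤ d) (hd3 : d + 1 ≤ 3) (hℓ : 1 ≤ ℓ) (hodd : Odd (ℓ + 1)) {a : ℝ} (ha : 0 < a) :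
    ∃ c₀ δ₀ : ℝ, 0 ≤ c₀ ∧ 0 < δ₀ ∧ ∀ (P : Params), P.d = d + 1 → P.L = ℓ + 1 →
      ∀ k : ℕ, 1 ≤ k → k ≤ P.K → 2 * (P.L ^ k - 1) + 4 < P.sitesPerDir 0 →
      ∀ (U : GaugeField P 0 U1) (Ω : Finset (Balaban1983to89.Site P 0)) (θ : ℝ), 0 ≤ θ →
        (∀ p : Balaban1983to89.Plaq P 0, (∃ y ∈ Ω, supDist y p.src ≤ 2 * P.L ^ k) → ‖toC (plaqHol U p) - 1‖ ≤ θ) →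
        (((P.L : ℝ) ^ k) ^ 2 * θ) ^ 2 ≤ 1 / 500 →
      ∀ (B : Finset (Balaban1983to89.Site P 0)), IsBlockUnion k B → IsBlockUnion k Ω → B ⊆ Ω →
      2 * (P.d : ℝ) ^ 3 * (((P.L : ℝ) ^ k) ^ 2 * θ) ^ 2 ≤ 1 ∧
      2 * (((P.L : ℝ) ^ k - 1) * (P.L : ℝ) ^ k) * P.d * (((P.d - 1 : ℕ) : ℝ) * ((P.L : ℝ) ^ k - 1) * θ) ^ 2 +
          2 * (P.d * ((P.L : ℝ) ^ k - 1) * (((P.d - 1 : ℕ) : ℝ) * ((P.L : ℝ) ^ k - 1) * θ)) ^ 2 ≤ 1 / 2 ∧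
      (∀ x ∈ B, ∀ (f : Balaban1983to89.Site P 0 → ℂ) (F D : ℝ), (∀ y, ‖f y‖ ≤ F) → 0 ≤ D →
          (∀ y, f y ≠ 0 → D ≤ B5Ineq137Torus.T P 0 x y) →
          ‖(gBox (B1RG242Torus.α P a k * (P.L : ℝ) ^ (k * P.d)) P.eps⁻¹ U k B *ᵥ f) x‖ ≤
            P.spacing k ^ 2 * (c₀ * Real.exp (-(δ₀ * (((P.L : ℝ) ^ k)⁻¹ * D))) * F)) ∧
      (∀ x ∈ B, ∀ (f : Balaban1983to89.Site P 0 → ℂ) (F D : ℝ), (∀ y, ‖f y‖ ≤ F) → 0 ≤ D →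
          (∀ y, f y ≠ 0 → D ≤ B5Ineq137Torus.T P 0 x y) →
          ‖(gBox (B1RG242Torus.α P a k * (P.L : ℝ) ^ (k * P.d)) P.eps⁻¹ U k Ω *ᵥ f) x‖ ≤
            P.spacing k ^ 2 * (c₀ * Real.exp (-(δ₀ * (((P.L : ℝ) ^ k)⁻¹ * D))) * F)) ∧
      (∀ x, (∀ y, B5Ineq137Torus.T P 0 x y < (P.L : ℝ) ^ k → y ∈ B) →
          ∀ (f : Balaban1983to89.Site P 0 → ℂ) (F D : ℝ), (∀ y, ‖f y‖ ≤ F) → 0 ≤ D →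
          (∀ y, f y ≠ 0 → D ≤ B5Ineq137Torus.T P 0 x y) → ∀ (μ : Fin P.d),
          ‖covD P.eps⁻¹ (cfg U) (gBox (B1RG242Torus.α P a k * (P.L : ℝ) ^ (k * P.d)) P.eps⁻¹ U k B *ᵥ f) ⟨x, μ⟩‖ ≤
            P.spacing k * (c₀ * Real.exp (-(δ₀ * (((P.L : ℝ) ^ k)⁻¹ * D))) * F)) ∧
      (∀ x, (∀ y, B5Ineq137Torus.T P 0 x y < (P.L : ℝ) ^ k → y ∈ B) →
          ∀ (f : Balaban1983to89.Site P 0 → ℂ) (F D : ℝ), (∀ y, ‖f y‖ ≤ F) → 0 ≤ D →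
          (∀ y, f y ≠ 0 → D ≤ B5Ineq137Torus.T P 0 x y) → ∀ (μ : Fin P.d),
          ‖covD P.eps⁻¹ (cfg U) (gBox (B1RG242Torus.α P a k * (P.L : ℝ) ^ (k * P.d)) P.eps⁻¹ U k Ω *ᵥ f) ⟨x, μ⟩‖ ≤
            P.spacing k * (c₀ * Real.exp (-(δ₀ * (((P.L : ℝ) ^ k)⁻¹ * D))) * F)) := by
  obtain ⟨δv, cv, hδv, hcv, HV⟩ := decay110_smoothNear_region d ℓ hd3 hℓ ha
  obtain ⟨td, cd, htd, hcd, HD⟩ := decay110_smoothNear_region_deriv_uniform d (ℓ + 1) hd1 hd3 ⟨hodd, by omega⟩ ha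
  refine ⟨max cv cd, min δv td, hcv.le.trans (le_max_left _ _), lt_min hδv htd, ?_⟩
  intro P hPd hPL k hk1 hkK hbig U Ω θ hθ0 hplaq hτ B hB hΩ hsub
  have hkm : k ≤ P.m + P.K := hkK.trans (Nat.le_add_left _ _)
  have hLr : (1 : ℝ) ≤ (P.L : ℝ) ^ k := one_le_pow₀ (B1RG242Torus.one_lt_cast_L P).le
  have hPk : (0 : ℝ) < (P.L : ℝ) ^ k := pow_pos P.cast_L_pos k
  have hdr : (P.d : ℝ) = (d : ℝ) + 1 := by rw [hPd]; push_cast; ring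
  have hd1r : (1 : ℝ) ≤ P.d := by rw [hdr]; linarith [(Nat.cast_nonneg d : (0 : ℝ) ≤ d)]
  have hd3r : (P.d : ℝ) ≤ 3 := by rw [hPd]; exact_mod_cast hd3
  obtain ⟨hsm1, hsm2⟩ := threshold_smallness hd1r hd3r hLr hθ0 hτ
  have hsk2 : 0 ≤ P.spacing k ^ 2 := sq_nonneg _
  have hsk : 0 ≤ P.spacing k := (P.spacing_pos k).le
  have hcast : ((P.d - 1 : ℕ) : ℝ) = (P.d : ℝ) - 1 := by rw [Nat.cast_sub P.hd, Nat.cast_one]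
  have hT : ((P.d - 1 : ℕ) : ℝ) * ((P.L : ℝ) ^ k - 1) * θ ≤ ((P.d : ℝ) - 1) * ((P.L : ℝ) ^ k - 1) * θ := by rw [hcast]
  have hsm2' : 2 * (((P.L : ℝ) ^ k - 1) * (P.L : ℝ) ^ k) * P.d * (((P.d - 1 : ℕ) : ℝ) * ((P.L : ℝ) ^ k - 1) * θ) ^ 2 +
      2 * (P.d * ((P.L : ℝ) ^ k - 1) * (((P.d - 1 : ℕ) : ℝ) * ((P.L : ℝ) ^ k - 1) * θ)) ^ 2 ≤ 1 / 2 := by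
    rw [hcast]; exact hsm2
  -- plaquettes near the smaller block union `B ⊆ Ω` are near `Ω`
  have hplaqB : ∀ p : Balaban1983to89.Plaq P 0, (∃ y ∈ B, supDist y p.src ≤ 2 * P.L ^ k) → ‖toC (plaqHol U p) - 1‖ ≤ θ :=
    fun p ⟨y, hy, hyp⟩ => hplaq p ⟨y, hsub hy, hyp⟩
  -- the value member of a block union `X` near which `u` is plaquette-small, at the common constants
  have hval : ∀ X : Finset (Balaban1983to89.Site P 0), IsBlockUnion k X →
      (∀ p : Balaban1983to89.Plaq P 0, (∃ y ∈ X, supDist y p.src ≤ 2 * P.L ^ k) → ‖toC (plaqHol U p) - 1‖ ≤ θ) →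
      ∀ (x : Balaban1983to89.Site P 0) (f : Balaban1983to89.Site P 0 → ℂ) (F D : ℝ), (∀ y, ‖f y‖ ≤ F) → 0 ≤ D →
      (∀ y, f y ≠ 0 → D ≤ B5Ineq137Torus.T P 0 x y) →
      ‖(gBox (B1RG242Torus.α P a k * (P.L : ℝ) ^ (k * P.d)) P.eps⁻¹ U k X *ᵥ f) x‖ ≤
        P.spacing k ^ 2 * (max cv cd * Real.exp (-(min δv td * (((P.L : ℝ) ^ k)⁻¹ * D))) * F) := by
    intro X hX hplaqX x f F D hF hD hsupp
    have hF0 : 0 ≤ F := (norm_nonneg _).trans (hF x)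
    refine (HV P hPd hPL k hk1 hkm hbig X hX U θ hθ0 hplaqX _ hT hsm2 x f F D hF hsupp).trans ?_
    exact mul_le_mul_of_nonneg_left (mono_bound hcv.le (le_max_left _ _) (min_le_left _ _) (mul_nonneg (inv_pos.2 hPk).le hD) hF0) hsk2
  -- the covariant-derivative member of a block union `X` near which `u` is plaquette-small, at the common constants
  have hder : ∀ X : Finset (Balaban1983to89.Site P 0), IsBlockUnion k X →
      (∀ p : Balaban1983to89.Plaq P 0, (∃ y ∈ X, supDist y p.src ≤ 2 * P.L ^ k) → ‖toC (plaqHol U p) - 1‖ ≤ θ) →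
      ∀ (x : Balaban1983to89.Site P 0), (∀ y, B5Ineq137Torus.T P 0 x y < (P.L : ℝ) ^ k → y ∈ X) →
      ∀ (f : Balaban1983to89.Site P 0 → ℂ) (F D : ℝ), (∀ y, ‖f y‖ ≤ F) → 0 ≤ D → (∀ y, f y ≠ 0 → D ≤ B5Ineq137Torus.T P 0 x y) →
      ∀ (μ : Fin P.d), ‖covD P.eps⁻¹ (cfg U) (gBox (B1RG242Torus.α P a k * (P.L : ℝ) ^ (k * P.d)) P.eps⁻¹ U k X *ᵥ f) ⟨x, μ⟩‖ ≤
        P.spacing k * (max cv cd * Real.exp (-(min δv td * (((P.L : ℝ) ^ k)⁻¹ * D))) * F) := by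
    intro X hX hplaqX x hball f F D hF hD hsupp μ
    have hF0 : 0 ≤ F := (norm_nonneg _).trans (hF x)
    have h := HD P hPd hPL k hk1 hkK hbig X hX U θ hθ0 hplaqX hsm1 _ hT hsm2 x μ f F D hF
      (fun z hz => by rw [← B3Bound323ZeroTorus.T_eq_supDist]; exact hsupp z hz)
      (fun w hw => by
        by_contra hlt
        exact hw (hball w (by rw [B3Bound323ZeroTorus.T_eq_supDist]; exact_mod_cast (not_le.1 hlt))))
    calc _ ≤ cd * P.spacing k * Real.exp (-(td * D / (P.L : ℝ) ^ k)) * F := h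
      _ = P.spacing k * (cd * Real.exp (-(td * (((P.L : ℝ) ^ k)⁻¹ * D))) * F) := by
          rw [show td * D / (P.L : ℝ) ^ k = td * (((P.L : ℝ) ^ k)⁻¹ * D) by ring]; ring
      _ ≤ P.spacing k * (max cv cd * Real.exp (-(min δv td * (((P.L : ℝ) ^ k)⁻¹ * D))) * F) :=
          mul_le_mul_of_nonneg_left (mono_bound hcd.le (le_max_right _ _) (min_le_right _ _) (mul_nonneg (inv_pos.2 hPk).le hD) hF0) hsk
  exact ⟨hsm1, hsm2', fun x _ f F D hF hD hsupp => hval B hB hplaqB x f F D hF hD hsupp,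
    fun x _ f F D hF hD hsupp => hval Ω hΩ hplaq x f F D hF hD hsupp,
    fun x hball f F D hF hD hsupp μ => hder B hB hplaqB x hball f F D hF hD hsupp μ,
    fun x hball f F D hF hD hsupp μ => hder Ω hΩ hplaq x (fun y hy => hsub (hball y hy)) f F D hF hD hsupp μ⟩

/-- **[Balaban1983RegularityDecay] (1.11)–(1.12), VALUE MEMBER, FOR NESTED `k`-BLOCK UNIONS `□ ⊆ Ω` AT A `U(1)` FIELD PLAQUETTE-SMALL NEAR `Ω`
ONLY, HYPOTHESIS-FREE, AT EVERY ROW `x ∈ □`** (p30 g29's `close112_smallPlaquette_region` under the printed local hypothesis): for `1 ≤ d`,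
`d + 1 ≤ 3`, `ℓ ≥ 1` with `ℓ + 1` odd, `a > 0` there are `c, δ > 0` such that for every volume (`P.d = d + 1`, `P.L = ℓ + 1`), every
`1 ≤ k ≤ K` with `2(L^k − 1) + 4 < |T|`, every region `Ω` and field `u` with `‖u(∂p) − 1‖ ≤ θ` for the plaquettes based within `2L^k` of `Ω`,
`0 ≤ θ`, `((L^k)²θ)² ≤ 1/500`, all nested `k`-block unions `□ ⊆ Ω`, EVERY row `x ∈ □` and every `f` supported in `□` (`‖f‖_∞ ≤ F`,
`D ≤ dist(x, supp f)`, `D_b ≤ dist(x, □^c)`, `D_f ≤ dist(supp f, □^c)`):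
`‖(G_k(□,u)f)(x) − (G_k(Ω,u)f)(x)‖ ≤ (L^kε)²·c e^{−δD/L^k}e^{−δ(D_b + D_f)/L^k}·F`.
[cite: Balaban1983RegularityDecay, Theorem p.573 (1.11)–(1.12)] [cite: BalabanImbrieJaffe1985, (7.3.1)–(7.3.2) p.326] [cite: BalabanImbrieJaffe1988, (2.31)–(2.32) p.263] -/
theorem close112_smoothNear_region (d ℓ : ℕ) (hd1 : 1 ≤ d) (hd3 : d + 1 ≤ 3) (hℓ : 1 ≤ ℓ) (hodd : Odd (ℓ + 1)) {a : ℝ} (ha : 0 < a) :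
    ∃ c δ : ℝ, 0 < c ∧ 0 < δ ∧ ∀ (P : Params), P.d = d + 1 → P.L = ℓ + 1 →
      ∀ k : ℕ, 1 ≤ k → k ≤ P.K → 2 * (P.L ^ k - 1) + 4 < P.sitesPerDir 0 →
      ∀ (U : GaugeField P 0 U1) (Ω : Finset (Balaban1983to89.Site P 0)) (θ : ℝ), 0 ≤ θ →
        (∀ p : Balaban1983to89.Plaq P 0, (∃ y ∈ Ω, supDist y p.src ≤ 2 * P.L ^ k) → ‖toC (plaqHol U p) - 1‖ ≤ θ) →
        (((P.L : ℝ) ^ k) ^ 2 * θ) ^ 2 ≤ 1 / 500 →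
      ∀ (B : Finset (Balaban1983to89.Site P 0)), IsBlockUnion k B → IsBlockUnion k Ω → B ⊆ Ω →
      ∀ x ∈ B, ∀ (f : Balaban1983to89.Site P 0 → ℂ) (F D Db Df : ℝ), (∀ y, ‖f y‖ ≤ F) → (∀ y, y ∉ B → f y = 0) →
        0 ≤ D → (∀ y, f y ≠ 0 → D ≤ B5Ineq137Torus.T P 0 x y) → 0 ≤ Db → (∀ w, w ∉ B → Db ≤ B5Ineq137Torus.T P 0 x w) →
        0 ≤ Df → (∀ y, f y ≠ 0 → ∀ w, w ∉ B → Df ≤ B5Ineq137Torus.T P 0 y w) →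
        ‖(gBox (B1RG242Torus.α P a k * (P.L : ℝ) ^ (k * P.d)) P.eps⁻¹ U k B *ᵥ f) x -
            (gBox (B1RG242Torus.α P a k * (P.L : ℝ) ^ (k * P.d)) P.eps⁻¹ U k Ω *ᵥ f) x‖ ≤
          P.spacing k ^ 2 * (c * Real.exp (-(δ * (((P.L : ℝ) ^ k)⁻¹ * D))) *
            Real.exp (-(δ * (((P.L : ℝ) ^ k)⁻¹ * (Db + Df)))) * F) := by
  obtain ⟨c₀, δ₀, hc₀, hδ₀, HI⟩ := inputs110_smoothNear_region d ℓ hd1 hd3 hℓ hodd ha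
  obtain ⟨c₁, δ₁, hc₁, hδ₁, HC⟩ := close112_smoothNear_of_inputs_allRows (d + 1) (ℓ + 1) (by omega) hd3 ⟨hodd, by omega⟩ ha hc₀ hδ₀
  refine ⟨c₁, δ₁, hc₁, hδ₁, ?_⟩
  intro P hPd hPL k hk1 hkK hbig U Ω θ hθ0 hplaq hτ B hB hΩ hsub x hx f F D Db Df hF hfB hD hsD hDb hsDb hDf hsDf
  obtain ⟨hsm1, hsm2, hGB, hGΩ, -, -⟩ := HI P hPd hPL k hk1 hkK hbig U Ω θ hθ0 hplaq hτ B hB hΩ hsub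
  exact HC P hPd hPL k hk1 hkK U Ω θ hθ0 hplaq hsm1 _ le_rfl hsm2 B hB hΩ hsub hGB hGΩ x hx f F D Db Df hF hfB hD hsD hDb hsDb hDf hsDf

/-- **[Balaban1983RegularityDecay] (1.11)–(1.12), COVARIANT-DERIVATIVE MEMBER, FOR NESTED `k`-BLOCK UNIONS `□ ⊆ Ω` AT A `U(1)` FIELD
PLAQUETTE-SMALL NEAR `Ω` ONLY, HYPOTHESIS-FREE** (p30 g29's `close112_smallPlaquette_region_deriv` under the printed local hypothesis): same data as
`close112_smoothNear_region`, rows `x ∈ □` with `L^k ≤ T(x, w)` for every `w ∉ □`, every `μ`: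
`‖covD ε⁻¹ u (G_k(□,u)f) ⟨x,μ⟩ − covD ε⁻¹ u (G_k(Ω,u)f) ⟨x,μ⟩‖ ≤ (L^kε)·c e^{−δD/L^k}e^{−δ(D_b + D_f)/L^k}·F`.
[cite: Balaban1983RegularityDecay, Theorem p.573 (1.10)–(1.12)] [cite: BalabanImbrieJaffe1985, (7.3.1)–(7.3.2) p.326] [cite: BalabanImbrieJaffe1988, (2.31)–(2.32) p.263] -/
theorem close112_smoothNear_region_deriv (d ℓ : ℕ) (hd1 : 1 ≤ d) (hd3 : d + 1 ≤ 3) (hℓ : 1 ≤ ℓ) (hodd : Odd (ℓ + 1)) {a : ℝ}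
    (ha : 0 < a) :
    ∃ c δ : ℝ, 0 < c ∧ 0 < δ ∧ ∀ (P : Params), P.d = d + 1 → P.L = ℓ + 1 →
      ∀ k : ℕ, 1 ≤ k → k ≤ P.K → 2 * (P.L ^ k - 1) + 4 < P.sitesPerDir 0 →
      ∀ (U : GaugeField P 0 U1) (Ω : Finset (Balaban1983to89.Site P 0)) (θ : ℝ), 0 ≤ θ →
        (∀ p : Balaban1983to89.Plaq P 0, (∃ y ∈ Ω, supDist y p.src ≤ 2 * P.L ^ k) → ‖toC (plaqHol U p) - 1‖ ≤ θ) →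
        (((P.L : ℝ) ^ k) ^ 2 * θ) ^ 2 ≤ 1 / 500 →
      ∀ (B : Finset (Balaban1983to89.Site P 0)), IsBlockUnion k B → IsBlockUnion k Ω → B ⊆ Ω →
      ∀ x ∈ B, (∀ w, w ∉ B → (P.L : ℝ) ^ k ≤ B5Ineq137Torus.T P 0 x w) →
      ∀ (f : Balaban1983to89.Site P 0 → ℂ) (F D Db Df : ℝ), (∀ y, ‖f y‖ ≤ F) → (∀ y, y ∉ B → f y = 0) →
        0 ≤ D → (∀ y, f y ≠ 0 → D ≤ B5Ineq137Torus.T P 0 x y) → 0 ≤ Db → (∀ w, w ∉ B → Db ≤ B5Ineq137Torus.T P 0 x w) →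
        0 ≤ Df → (∀ y, f y ≠ 0 → ∀ w, w ∉ B → Df ≤ B5Ineq137Torus.T P 0 y w) → ∀ (μ : Fin P.d),
        ‖covD P.eps⁻¹ (cfg U) (gBox (B1RG242Torus.α P a k * (P.L : ℝ) ^ (k * P.d)) P.eps⁻¹ U k B *ᵥ f) ⟨x, μ⟩ -
            covD P.eps⁻¹ (cfg U) (gBox (B1RG242Torus.α P a k * (P.L : ℝ) ^ (k * P.d)) P.eps⁻¹ U k Ω *ᵥ f) ⟨x, μ⟩‖ ≤
          P.spacing k * (c * Real.exp (-(δ * (((P.L : ℝ) ^ k)⁻¹ * D))) *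
            Real.exp (-(δ * (((P.L : ℝ) ^ k)⁻¹ * (Db + Df)))) * F) := by
  obtain ⟨c₀, δ₀, hc₀, hδ₀, HI⟩ := inputs110_smoothNear_region d ℓ hd1 hd3 hℓ hodd ha
  obtain ⟨c₂, δ₂, hc₂, hδ₂, HC⟩ :=
    close112_smoothNear_deriv_of_inputs_ballRows (d + 1) (ℓ + 1) (by omega) hd3 ⟨hodd, by omega⟩ ha hc₀ hδ₀
  refine ⟨c₂, δ₂, hc₂, hδ₂, ?_⟩
  intro P hPd hPL k hk1 hkK hbig U Ω θ hθ0 hplaq hτ B hB hΩ hsub x hx hrow f F D Db Df hF hfB hD hsD hDb hsDb hDf hsDf μ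
  obtain ⟨hsm1, hsm2, hGB, hGΩ, hDB, hDΩ⟩ := HI P hPd hPL k hk1 hkK hbig U Ω θ hθ0 hplaq hτ B hB hΩ hsub
  exact HC P hPd hPL k hk1 hkK U Ω θ hθ0 hplaq hsm1 _ le_rfl hsm2 B hB hΩ hsub hGB hGΩ hDB hDΩ x hx hrow f F D Db Df hF hfB hD hsD hDb
    hsDb hDf hsDf μ

/-! ## §5 The same under the printed (2.32): r18's `SmoothOn` near `Ω` -/

/-- **(1.11)–(1.12), VALUE MEMBER, FOR NESTED `k`-BLOCK UNIONS `□ ⊆ Ω` UNDER THE PRINTED (2.32)** (p. 263: *"for (2.31) we assume smoothness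
throughout the subset Ω ⊂ T_η. This means that in a neighborhood of each □_α there exists an A, λ such that u = exp[ie_kη(A + ∂λ)] with |∂A|,
|∂*A| ≦ O(p(e_k)). (2.32)"*): `close112_smoothNear_region` with the plaquette hypothesis discharged from r18's `SmoothOn e_k η C 𝓅 X B Pl (cfg u)`
whenever `Pl` contains the plaquettes based within `2L^k` of `Ω` and `B` their bonds (gen 20's `plaqSmall_near_of_smoothOn`), threshold
`(L^{2k}·e_kη²C𝓅)² ≤ 1/500` (`0 ≤ e_k`, `0 ≤ C𝓅`).
[cite: BalabanImbrieJaffe1988, (2.31)–(2.32) p.263] [cite: Balaban1983RegularityDecay, Theorem p.573 (1.11)–(1.12)] -/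
theorem close112_smoothOn_region (d ℓ : ℕ) (hd1 : 1 ≤ d) (hd3 : d + 1 ≤ 3) (hℓ : 1 ≤ ℓ) (hodd : Odd (ℓ + 1)) {a : ℝ} (ha : 0 < a) :
    ∃ c δ : ℝ, 0 < c ∧ 0 < δ ∧ ∀ (P : Params), P.d = d + 1 → P.L = ℓ + 1 →
      ∀ k : ℕ, 1 ≤ k → k ≤ P.K → 2 * (P.L ^ k - 1) + 4 < P.sitesPerDir 0 →
      ∀ (U : GaugeField P 0 U1) (Ω : Finset (Balaban1983to89.Site P 0)) (ek η C pek : ℝ), 0 ≤ ek → 0 ≤ C * pek →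
      ∀ (X : Finset (Balaban1983to89.Site P 0)) (Bd : Finset (PBond P 0)) (Pl : Finset (Balaban1983to89.Plaq P 0)),
        SmoothOn ek η C pek X Bd Pl (cfg U) →
        (∀ p : Balaban1983to89.Plaq P 0, (∃ y ∈ Ω, supDist y p.src ≤ 2 * P.L ^ k) → p ∈ Pl) →
        (∀ p ∈ Pl, (⟨p.src, p.μ⟩ : PBond P 0) ∈ Bd ∧ (⟨p.src.shift p.μ, p.ν⟩ : PBond P 0) ∈ Bd ∧
          (⟨p.src.shift p.ν, p.μ⟩ : PBond P 0) ∈ Bd ∧ (⟨p.src, p.ν⟩ : PBond P 0) ∈ Bd) →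
        (((P.L : ℝ) ^ k) ^ 2 * (ek * η ^ 2 * (C * pek))) ^ 2 ≤ 1 / 500 →
      ∀ (B : Finset (Balaban1983to89.Site P 0)), IsBlockUnion k B → IsBlockUnion k Ω → B ⊆ Ω →
      ∀ x ∈ B, ∀ (f : Balaban1983to89.Site P 0 → ℂ) (F D Db Df : ℝ), (∀ y, ‖f y‖ ≤ F) → (∀ y, y ∉ B → f y = 0) →
        0 ≤ D → (∀ y, f y ≠ 0 → D ≤ B5Ineq137Torus.T P 0 x y) → 0 ≤ Db → (∀ w, w ∉ B → Db ≤ B5Ineq137Torus.T P 0 x w) →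
        0 ≤ Df → (∀ y, f y ≠ 0 → ∀ w, w ∉ B → Df ≤ B5Ineq137Torus.T P 0 y w) →
        ‖(gBox (B1RG242Torus.α P a k * (P.L : ℝ) ^ (k * P.d)) P.eps⁻¹ U k B *ᵥ f) x -
            (gBox (B1RG242Torus.α P a k * (P.L : ℝ) ^ (k * P.d)) P.eps⁻¹ U k Ω *ᵥ f) x‖ ≤
          P.spacing k ^ 2 * (c * Real.exp (-(δ * (((P.L : ℝ) ^ k)⁻¹ * D))) *
            Real.exp (-(δ * (((P.L : ℝ) ^ k)⁻¹ * (Db + Df)))) * F) := by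
  obtain ⟨c, δ, hc, hδ, H⟩ := close112_smoothNear_region d ℓ hd1 hd3 hℓ hodd ha
  refine ⟨c, δ, hc, hδ, ?_⟩
  intro P hPd hPL k hk1 hkK hbig U Ω ek η C pek hek hCp X Bd Pl hS hPl hBd hτ B hB hΩ hsub x hx f F D Db Df hF hfB hD hsD hDb hsDb hDf
    hsDf
  exact H P hPd hPL k hk1 hkK hbig U Ω (ek * η ^ 2 * (C * pek)) (by positivity) (plaqSmall_near_of_smoothOn hek hS hPl hBd) hτ B hB hΩ
    hsub x hx f F D Db Df hF hfB hD hsD hDb hsDb hDf hsDf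

/-- **(1.11)–(1.12), COVARIANT-DERIVATIVE MEMBER, FOR NESTED `k`-BLOCK UNIONS `□ ⊆ Ω` UNDER THE PRINTED (2.32)**: `close112_smoothNear_region_deriv`
with the plaquette hypothesis discharged from r18's `SmoothOn e_k η C 𝓅 X B Pl (cfg u)` (`Pl ⊇` the plaquettes based within `2L^k` of `Ω`, `B ⊇`
their bonds), threshold `(L^{2k}·e_kη²C𝓅)² ≤ 1/500`.
[cite: BalabanImbrieJaffe1988, (2.31)–(2.32) p.263] [cite: Balaban1983RegularityDecay, Theorem p.573 (1.10)–(1.12)] -/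
theorem close112_smoothOn_region_deriv (d ℓ : ℕ) (hd1 : 1 ≤ d) (hd3 : d + 1 ≤ 3) (hℓ : 1 ≤ ℓ) (hodd : Odd (ℓ + 1)) {a : ℝ}
    (ha : 0 < a) :
    ∃ c δ : ℝ, 0 < c ∧ 0 < δ ∧ ∀ (P : Params), P.d = d + 1 → P.L = ℓ + 1 →
      ∀ k : ℕ, 1 ≤ k → k ≤ P.K → 2 * (P.L ^ k - 1) + 4 < P.sitesPerDir 0 →
      ∀ (U : GaugeField P 0 U1) (Ω : Finset (Balaban1983to89.Site P 0)) (ek η C pek : ℝ), 0 ≤ ek → 0 ≤ C * pek →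
      ∀ (X : Finset (Balaban1983to89.Site P 0)) (Bd : Finset (PBond P 0)) (Pl : Finset (Balaban1983to89.Plaq P 0)),
        SmoothOn ek η C pek X Bd Pl (cfg U) →
        (∀ p : Balaban1983to89.Plaq P 0, (∃ y ∈ Ω, supDist y p.src ≤ 2 * P.L ^ k) → p ∈ Pl) →
        (∀ p ∈ Pl, (⟨p.src, p.μ⟩ : PBond P 0) ∈ Bd ∧ (⟨p.src.shift p.μ, p.ν⟩ : PBond P 0) ∈ Bd ∧
          (⟨p.src.shift p.ν, p.μ⟩ : PBond P 0) ∈ Bd ∧ (⟨p.src, p.ν⟩ : PBond P 0) ∈ Bd) →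
        (((P.L : ℝ) ^ k) ^ 2 * (ek * η ^ 2 * (C * pek))) ^ 2 ≤ 1 / 500 →
      ∀ (B : Finset (Balaban1983to89.Site P 0)), IsBlockUnion k B → IsBlockUnion k Ω → B ⊆ Ω →
      ∀ x ∈ B, (∀ w, w ∉ B → (P.L : ℝ) ^ k ≤ B5Ineq137Torus.T P 0 x w) →
      ∀ (f : Balaban1983to89.Site P 0 → ℂ) (F D Db Df : ℝ), (∀ y, ‖f y‖ ≤ F) → (∀ y, y ∉ B → f y = 0) →
        0 ≤ D → (∀ y, f y ≠ 0 → D ≤ B5Ineq137Torus.T P 0 x y) → 0 ≤ Db → (∀ w, w ∉ B → Db ≤ B5Ineq137Torus.T P 0 x w) →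
        0 ≤ Df → (∀ y, f y ≠ 0 → ∀ w, w ∉ B → Df ≤ B5Ineq137Torus.T P 0 y w) → ∀ (μ : Fin P.d),
        ‖covD P.eps⁻¹ (cfg U) (gBox (B1RG242Torus.α P a k * (P.L : ℝ) ^ (k * P.d)) P.eps⁻¹ U k B *ᵥ f) ⟨x, μ⟩ -
            covD P.eps⁻¹ (cfg U) (gBox (B1RG242Torus.α P a k * (P.L : ℝ) ^ (k * P.d)) P.eps⁻¹ U k Ω *ᵥ f) ⟨x, μ⟩‖ ≤
          P.spacing k * (c * Real.exp (-(δ * (((P.L : ℝ) ^ k)⁻¹ * D))) *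
            Real.exp (-(δ * (((P.L : ℝ) ^ k)⁻¹ * (Db + Df)))) * F) := by
  obtain ⟨c, δ, hc, hδ, H⟩ := close112_smoothNear_region_deriv d ℓ hd1 hd3 hℓ hodd ha
  refine ⟨c, δ, hc, hδ, ?_⟩
  intro P hPd hPL k hk1 hkK hbig U Ω ek η C pek hek hCp X Bd Pl hS hPl hBd hτ B hB hΩ hsub x hx hrow f F D Db Df hF hfB hD hsD hDb hsDb
    hDf hsDf μ
  exact H P hPd hPL k hk1 hkK hbig U Ω (ek * η ^ 2 * (C * pek)) (by positivity) (plaqSmall_near_of_smoothOn hek hS hPl hBd) hτ B hB hΩ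
    hsub x hx hrow f F D Db Df hF hfB hD hsD hDb hsDb hDf hsDf μ

end Package

end

end Literature.MathematicalPhysics.QuantumFieldTheory.BalabanImbrieJaffe1984to88.BIJ88NeumannPropagatorSmoothNearCloseDeriv
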